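import Mathlib.Analysis.SpecialFunctions.Pow.Real
import Mathlib.Analysis.SpecialFunctions.Log.Basic
import HarnessLib

/-!
# `RigorousRGSmallParameter` (Slade, Theorem 1.4.1): the change of variables of §5.3
# (Proposition 5.3.1) and the perturbative fixed point of §5.4

Companion ("proof architecture") file of
`Literature/Barriers/CriticalPhenomena/RigorousRGSmallParameter.lean` (the barrier is literally
`LongRangePhi4.Slade2017_thm141`, Slade's Theorem 1.4.1), next to
`RigorousRGSmallParameterFlowExponent.lean` (§8.1) and the §2–§4 files. Source: G. Slade,
*Critical exponents for long-range `O(n)` models below the upper critical dimension*, Commun.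
Math. Phys. 358 (2018) 343–436, arXiv:1611.06169, §5 "Perturbative flow equations":
Proposition 5.1.1 (the second-order map `Φ_pt`), the rescaled coefficients of §5.2, §5.3 "Change
of variables" with Proposition 5.3.1, and §5.4 "Perturbative fixed point". The form of `Φ_pt` is
the `z = y = 0` specialisation of R. Bauerschmidt, D. Brydges, G. Slade, *A renormalisation group
method. III. Perturbative analysis*, J. Stat. Phys. 159 (2015) 492–529, arXiv:1403.7252,
Proposition 4.1.1 (the change of variables `T_j` of its §4.2 and Proposition 4.2.1 there are the
`d = 4` model of Slade's §5.3), as Slade states in the proof of Proposition 5.1.1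
([BauerschmidtBrydgesSlade2015RGIII]).

## Where this sits in the printed proof

The sibling files reduce the barrier to the named fact `LongRangePhi4.Slade2017_prop822`, the
output of the renormalisation-group flow of §7–§8.1. That flow is run in the transformed
variables `(s, μ)` of §5.3: Lemma 7.1.1 ("the flow equations written in terms of `μ` and `y`")
is, by its printed proof, "Proposition 5.3.1, (5.4 displays), and the bounds on `R_+`". This file
makes the algebraic part of that step unconditional: the rescaled second-order flow `Φ^{(0)}_{pt,j}`
of §5.3, the quadratic change of variables `T_j`, the transformed map `Φ̄_j` with the coefficients
`β^:_j`, `ξ^W_j` of §5.2, and **Proposition 5.3.1** in conjugation form with explicit constants,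
together with the perturbative fixed point `s̄ = a⁻¹(1 - L^{-ε})` and the `ȳ`-recursion of §5.4.

## The objects (Slade §5.1–§5.3, in the rescaled variables `ĝ_j = L^{εj}g_j`, `μ̂_j = L^{αj}ν_j`)

With `C = C_{j+1;0,0}`, `w = w_j`, `η'_j = (n+2)C`, `β'_j = (n+8)δ[w^{(2)}]`, `γ̂ = (n+2)/(n+8)` and
`δ[f(ν,w)] = f(ν⁺,w₊) - f(ν,w)`, `ν⁺ = ν + η'g` (§5.1), Proposition 5.1.1 gives, for `j < j_m`,
`g_pt = g - β'_j g² - 4g δ[νw^{(1)}]`,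
`ν_pt = ν + η'_j(g + 4gνw^{(1)}) - ξ'_j g² - γ̂β'_j νg - δ[ν²w^{(1)}]`. In the rescaled coefficients
of §5.2 (`β_j = L^{-ε(j∧j_m)}β'_j`, `η_j = L^{(d-α)j}η'_j`, `ξ_j = L^{(α-2ε)j}ξ'_j`,
`w̄_j^{(1)} = L^{-α(j∧j_m)}w_j^{(1)}`, `η_{≥j} = Σ_{k≥j} L^{-(d-α)(k-j)}η_k`, so that
`η_j = η_{≥j} - L^{-(d-α)}η_{≥j+1}`, `L^{-(d-α)} = L^{ε}/L^{α}` as `ε = 2α - d`) the first display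
of §5.3 reads
`ĝ₊ = L^ε(ĝ - β_jĝ² - 4ĝ δ[μ̂w̄^{(1)}])`, `μ̂₊ = L^α(μ̂ + η_j(ĝ + 4ĝμ̂w̄^{(1)}) - γ̂β_jĝμ̂ - ξ_jĝ² - δ[μ̂²w̄^{(1)}])`,
`δ[μ̂w̄^{(1)}] = (μ̂ + η_jĝ)L^αw̄_{j+1}^{(1)} - μ̂w̄_j^{(1)}`,
`δ[μ̂²w̄^{(1)}] = (μ̂ + η_jĝ)²L^αw̄_{j+1}^{(1)} - μ̂²w̄_j^{(1)}` — this is `ptFlowG`, `ptFlowM` below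
(`Φ^{(0)}_{pt,j}`, the map `Φ_{pt,j}` with the `u`-component suppressed). The change of variables
`T_j(ĝ,μ̂) = (s,μ)`, `s = ĝ + 4ĝ(μ̂ + η_{≥j}ĝ)w̄_j^{(1)}`,
`μ = μ̂ + η_{≥j}(ĝ + 4ĝμ̂w̄_j^{(1)}) + μ̂²w̄_j^{(1)}` is `cvS`, `cvM`; the transformed map
`Φ̄_j(s̄_j, μ̄_j) = (L^ε s̄_j(1 - β^:_j s̄_j), L^α(μ̄_j - γ̂β_jμ̄_js̄_j - ξ^W_j s̄_j²))` is `barFlowS`,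
`barFlowM`, with `β^:_j = β_j + 4(η_{≥j}w̄_j^{(1)} - η_{≥j+1}w̄_{j+1}^{(1)})` (`betaW`) and
`ξ^W_j = ξ_j - γ̂β_jη_{≥j} + L^{-(d-α)}η_{≥j+1}β_j` (`xiW`; printed as a decorated `ξ`).

**On the transcription.** The held text of arXiv:1611.06169 is a macro-stripped TeX extraction in
which the symbols `ĝ`, `η`, `ξ`, `γ̂` are lost; the displays above were reconstructed from it with
the legible [BBS-rg-pt] formulas as the key, and then *verified algebraically*: with exactly these
definitions the conjugation defect `T_{j+1} ∘ Φ^{(0)}_{pt,j} - Φ̄_j ∘ T_j` has no term of degree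
`≤ 2` in `(ĝ, μ̂)` in the `μ`-component (this exact second-order cancellation fails if `γ̂` is
dropped from either of its two occurrences), and in the `s`-component its only term of degree `≤ 2` is
`4L^ε(L^ε - 1)η_{≥j+1}w̄_{j+1}^{(1)}ĝ²` — the `O(ε)|s|²` term of Proposition 5.3.1 (the printed
proof attributes it to `(L^ε-1)4η_{≥j}w̄_j^{(1)}`; its preceding display gives
`β̃_j = β_j + 4η_{≥j}w̄^{(1)}_j - 4L^εη_{≥j+1}w̄^{(1)}_{j+1} = β^:_j - 4(L^ε-1)η_{≥j+1}w̄^{(1)}_{j+1}`,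
which is what the identities below confirm; either way the term is `O(ε)s²`). The identities
`Slade2017_prop531_fst_eq`, `Slade2017_prop531_snd_eq` are checked by `ring`, so the kernel has
re-verified this bookkeeping.

## What this file proves (everything; no named fact is introduced)

* `Slade2017_prop531_fst`, `Slade2017_prop531_snd` — **Proposition 5.3.1 in conjugation form with
  explicit constants**: for `|ĝ|, |μ̂| ≤ 1` and all coefficients bounded by `B ≥ 1`
  (`|L^α|, |β_j|, |γ̂|, |ξ_j|, |w̄_j^{(1)}|, |w̄_{j+1}^{(1)}|, |η_{≥j}|, |η_{≥j+1}| ≤ B`, `0 ≤ L^{-(d-α)} ≤ 1`),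
  `|(T_{j+1}Φ^{(0)}_{pt,j}(ĝ,μ̂))_s - Φ̄_j(T_j(ĝ,μ̂))_s - 4L^ε(L^ε-1)η_{≥j+1}w̄^{(1)}_{j+1}s²| ≤ 1968 B^{10}(|ĝ|³ + |μ̂|³)`,
  `|(T_{j+1}Φ^{(0)}_{pt,j}(ĝ,μ̂))_μ - Φ̄_j(T_j(ĝ,μ̂))_μ| ≤ 1667 B^{11}(|ĝ|³ + |μ̂|³)`, `s = T_j(ĝ,μ̂)_s`;
  i.e. `T_{j+1} ∘ Φ^{(0)}_{pt,j} = (Φ̄_j + e_{pt,j}) ∘ T_j` with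
  `e_{pt,j}(s,μ) = O(|s|³ + |s|²ε + |μ|³)` uniformly in every range of `(j, m²)` on which the
  coefficients are uniformly bounded (Lemma 5.2.1: `j ≤ j_m`, `m² ∈ [0, m̄²]`), the `ε` entering
  through `0 ≤ L^ε - 1 ≤ εL^ε log L` (`rpow_sub_one_le`). The printed statement composes with
  `T_j⁻¹` on a `j`-independent ball; of the inverse only the a-priori bound and the injectivity
  are proved here (below), not the surjectivity onto a ball (it is the standard inverse of a
  quadratic perturbation of the unipotent linear map `(ĝ,μ̂) ↦ (ĝ, μ̂ + η_{≥j}ĝ)`,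
  cf. `Literature.Analysis.Calculus.exists_quadraticSolutionMap`).
* `Slade2017_sbar_fixedPoint`, `Slade2017_sbar_unique`, `Slade2017_sbar_pos`,
  `Slade2017_sbar_le`, `Slade2017_le_sbar` — §5.4: `s̄ = a⁻¹(1 - L^{-ε})` is the non-zero solution
  of `s̄ = L^ε s̄(1 - as̄)`, and `εL^{-ε} log L ≤ as̄ ≤ ε log L` ("`as̄ ∼ ε log L` as `ε ↓ 0`", `s̄ = O(ε)`).
* `Slade2017_ybar_recursion` — the first display "(5.4.0)": with `ȳ_j = s̄ - s̄_j` and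
  `s̄_{j+1} = L^ε s̄_j(1 - β^:_j s̄_j)`,
  `ȳ_{j+1} = c_ε ȳ_j + L^ε(aȳ_j² + (β^:_j - a)(s̄ - ȳ_j)²)`, `c_ε = 2 - L^ε`; and
  `Slade2017_cEps_lt_one`, `Slade2017_one_sub_cEps_le`: `c_ε = 1 - x`, `0 < x = L^ε - 1 ≤ εL^ε log L`.

Ledger effect: none on the trust base of the barrier's reduction chain (`Slade2017_prop822`
remains the named fact); this file makes the algebra of §5.3–§5.4 feeding Lemma 7.1.1 unconditional.
* `cvS_add_sub_cvS_le`, `cvM_add_sub_cvM_le` — increments of `T_j` on the unit ball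
  (`|T_j(x+ρ) - T_j(x)| ≤ 21B²|ρ|₁`), through which the third-order remainders of the
  renormalisation-group map enter; `abs_cvS_sub_le`, `abs_cvM_sub_le`,
  `Slade2017_changeVar_apriori`, `Slade2017_changeVar_injOn` — the quadratic part of `T_j` is
  quadratically small, and on the `j`-independent ball `|ĝ|, |μ̂| ≤ 1/(42B³)` (resp. `1/(504B³)`)
  `max(|ĝ|,|μ̂|) ≤ 2(1+B)(|s|+|μ|)` and `T_j` is injective with a `2(1+B)`-Lipschitz inverse: the
  a-priori half of "`T_j⁻¹` exists on a `j`-independent ball, `T_j⁻¹(s,μ) = (s, μ - η_{≥j}s) + O(|s|²+|μ|²)`".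
* `Slade2017_lem711_y`, `Slade2017_lem711_mu` — **Lemma 7.1.1, algebraic part**: for the actual
  flow `(ĝ_{j+1}, μ̂_{j+1}) = Φ^{(0)}_{pt,j}(ĝ_j,μ̂_j) + (ρ_g, ρ_μ)` (rescaled remainders of `R_+`) and
  `(s_j,μ_j) = T_j(ĝ_j,μ̂_j)`, `y_j = s̄ - s_j`, the recursions
  `y_{j+1} = c_εy_j + aL^εy_j² + (β^:_j - a)L^ε(s̄ - y_j)² + r_{y,j}`,
  `μ_{j+1} = L^αμ_j + ρ_{μ,j} + r_{μ,j}` of display (7.1.1) hold with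
  `|r_{y,j}| ≤ 4B³(L^ε-1)s_j² + 1968B^{10}(|ĝ_j|³+|μ̂_j|³) + 21B²(|ρ_g|+|ρ_μ|)`,
  `|r_{μ,j}| ≤ 1667B^{11}(|ĝ_j|³+|μ̂_j|³) + 9B²(|ρ_g|+|ρ_μ|)` — the printed `O(s̄³)` once
  `ĝ_j, μ̂_j = O(s̄)`, `ρ = O(s̄³)` and `L^ε - 1 = O(ε)`.

Not treated: the surjectivity of `T_j` onto a `j`-independent ball and the analyticity clause of
Proposition 5.3.1, the coefficient bounds Lemmas 5.2.1–5.2.4 (§10), the `K`-coordinate and the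
derivative bounds of Lemma 7.1.1, the second display of (5.4.0) (it is `barFlowM` with `s̄_j = s̄ - ȳ_j`).
-/

noncomputable section

namespace Literature.Barriers.CriticalPhenomena

open Real

namespace LongRangePhi4

/-! ### The maps of §5.3 -/

/-- The `ĝ`-component of the rescaled second-order flow `Φ^{(0)}_{pt,j}` (first display of §5.3):
`ĝ₊ = L^ε(ĝ - β_jĝ² - 4ĝ δ[μ̂w̄^{(1)}])`, `δ[μ̂w̄^{(1)}] = (μ̂ + η_jĝ)L^αw̄^{(1)}_{j+1} - μ̂w̄^{(1)}_j`.
Arguments: `Lε = L^ε`, `Lα = L^α`, `β = β_j`, `η = η_j`, `w₀ = w̄_j^{(1)}`, `w₁ = w̄_{j+1}^{(1)}`,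
then `ĝ`, `μ̂`. [cite: Slade2017, §5.3 (first display) and Proposition 5.1.1]
[cite: BauerschmidtBrydgesSlade2015RGIII, Proposition 4.1.1 (display for `g_pt`)] -/
def ptFlowG (Lε Lα β η w₀ w₁ g μ : ℝ) : ℝ :=
  Lε * (g - β * g ^ 2 - 4 * g * ((μ + η * g) * Lα * w₁ - μ * w₀))

/-- The `μ̂`-component of `Φ^{(0)}_{pt,j}` (first display of §5.3):
`μ̂₊ = L^α(μ̂ + η_j(ĝ + 4ĝμ̂w̄^{(1)}_j) - γ̂β_jĝμ̂ - ξ_jĝ² - δ[μ̂²w̄^{(1)}])`,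
`δ[μ̂²w̄^{(1)}] = (μ̂ + η_jĝ)²L^αw̄^{(1)}_{j+1} - μ̂²w̄^{(1)}_j`. Arguments: `Lα, β_j, γ̂, ξ_j, η_j,
w̄_j^{(1)}, w̄_{j+1}^{(1)}`, then `ĝ`, `μ̂`. [cite: Slade2017, §5.3 (first display) and Proposition 5.1.1]
[cite: BauerschmidtBrydgesSlade2015RGIII, Proposition 4.1.1 (display for `ν_pt`)] -/
def ptFlowM (Lα β γh ξ η w₀ w₁ g μ : ℝ) : ℝ :=
  Lα * (μ + η * (g + 4 * g * μ * w₀) - γh * β * g * μ - ξ * g ^ 2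
    - ((μ + η * g) ^ 2 * Lα * w₁ - μ ^ 2 * w₀))

/-- The `s`-component of the change of variables `T_j(ĝ, μ̂) = (s, μ)` of §5.3:
`s = ĝ + 4ĝ(μ̂ + η_{≥j}ĝ)w̄_j^{(1)}`. Arguments: `ηge = η_{≥j}`, `w = w̄_j^{(1)}`, then `ĝ`, `μ̂`.
[cite: Slade2017, §5.3 (display defining `T_j`)] -/
def cvS (ηge w g μ : ℝ) : ℝ := g + 4 * g * (μ + ηge * g) * w

/-- The `μ`-component of `T_j`: `μ = μ̂ + η_{≥j}(ĝ + 4ĝμ̂w̄_j^{(1)}) + μ̂²w̄_j^{(1)}`.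
[cite: Slade2017, §5.3 (display defining `T_j`)] -/
def cvM (ηge w g μ : ℝ) : ℝ := μ + ηge * (g + 4 * g * μ * w) + μ ^ 2 * w

/-- `β^:_j = β_j + 4(η_{≥j}w̄_j^{(1)} - η_{≥j+1}w̄_{j+1}^{(1)})` (§5.2). Arguments
`β_j, η_{≥j}, w̄_j^{(1)}, η_{≥j+1}, w̄_{j+1}^{(1)}`. [cite: Slade2017, §5.2 (display defining `β^:_j`)] -/
def betaW (β η₀ w₀ η₁ w₁ : ℝ) : ℝ := β + 4 * (η₀ * w₀ - η₁ * w₁)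

/-- The coefficient of `s̄_j²` in the `μ̄`-equation of `Φ̄_j` (a decorated `ξ` in print):
`ξ^W_j = ξ_j - γ̂β_jη_{≥j} + L^{-(d-α)}η_{≥j+1}β_j` (§5.2, the display after `β^:_j`). Arguments
`r = L^{-(d-α)}, β_j, γ̂, ξ_j, η_{≥j}, η_{≥j+1}`. [cite: Slade2017, §5.2 (display after `β^:_j`)] -/
def xiW (r β γh ξ η₀ η₁ : ℝ) : ℝ := ξ - γh * β * η₀ + r * η₁ * β

/-- The `s`-component of `Φ̄_j`: `s̄_{j+1} = L^ε s̄_j(1 - β^:_j s̄_j)` (§5.3, display defining `Φ̄_j`).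
[cite: Slade2017, §5.3 (display defining `Φ̄_j`)] -/
def barFlowS (Lε βW s : ℝ) : ℝ := Lε * s * (1 - βW * s)

/-- The `μ`-component of `Φ̄_j`: `μ̄_{j+1} = L^α(μ̄_j - γ̂β_jμ̄_js̄_j - ξ^W_j s̄_j²)` (§5.3).
Arguments `Lα, γ̂, β_j, ξ^W_j`, then `s̄_j`, `μ̄_j`. [cite: Slade2017, §5.3 (display defining `Φ̄_j`)] -/
def barFlowM (Lα γh β ξW s μ : ℝ) : ℝ := Lα * (μ - γh * β * μ * s - ξW * s ^ 2)

/-- The linear parts: `T_j(ĝ, μ̂) = (ĝ, μ̂ + η_{≥j}ĝ) + O(|ĝ|² + |μ̂|²)` — exactly,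
`s - ĝ = 4ĝ(μ̂ + η_{≥j}ĝ)w̄` and `μ - (μ̂ + η_{≥j}ĝ) = (4η_{≥j}ĝμ̂ + μ̂²)w̄`.
[cite: Slade2017, §5.3 (display after the definition of `T_j`)] -/
theorem cvS_sub_linear (ηge w g μ : ℝ) : cvS ηge w g μ - g = 4 * g * (μ + ηge * g) * w := by
  unfold cvS; ring

/-- `μ - (μ̂ + η_{≥j}ĝ) = (4η_{≥j}ĝμ̂ + μ̂²)w̄`: the `μ`-component of `T_j` minus its linear part.
[cite: Slade2017, §5.3 (display after the definition of `T_j`)] -/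
theorem cvM_sub_linear (ηge w g μ : ℝ) :
    cvM ηge w g μ - (μ + ηge * g) = (4 * ηge * g * μ + μ ^ 2) * w := by
  unfold cvM; ring

/-! ### Elementary inequalities used to bound the cubic remainders -/

/-- `|q| ≤ q·B⁰` for `q ≥ 0` (start of a monomial bound). [folklore] -/
private theorem abs_base {q B : ℝ} (hq : 0 ≤ q) : |q| ≤ q * B ^ 0 := by
  rw [abs_of_nonneg hq, pow_zero, mul_one]

/-- `|x| ≤ KBⁿ`, `|y| ≤ B` ⇒ `|xy| ≤ KBⁿ⁺¹`. [folklore] -/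
private theorem abs_step {K x y B : ℝ} {n : ℕ} (hx : |x| ≤ K * B ^ n) (hy : |y| ≤ B) :
    |x * y| ≤ K * B ^ (n + 1) := by
  rw [abs_mul, pow_succ, ← mul_assoc]
  exact mul_le_mul hx hy (abs_nonneg _) ((abs_nonneg x).trans hx)

/-- `|x| ≤ K`, `|y| ≤ 1` ⇒ `|xy| ≤ K`. [folklore] -/
private theorem abs_step1 {K x y : ℝ} (hx : |x| ≤ K) (hy : |y| ≤ 1) : |x * y| ≤ K := by
  rw [abs_mul]
  calc |x| * |y| ≤ K * 1 := mul_le_mul hx hy (abs_nonneg _) ((abs_nonneg x).trans hx)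
    _ = K := mul_one K

/-- `|x| ≤ KBⁿ`, `n ≤ D`, `B ≥ 1` ⇒ `|x| ≤ KB^D`. [folklore] -/
private theorem abs_top {K x B : ℝ} {n D : ℕ} (hB : 1 ≤ B) (hK : 0 ≤ K) (hnD : n ≤ D)
    (hx : |x| ≤ K * B ^ n) : |x| ≤ K * B ^ D :=
  hx.trans (mul_le_mul_of_nonneg_left (pow_le_pow_right₀ hB hnD) hK)

/-- `|x| ≤ K ⇒ |-x| ≤ K`. [folklore] -/
private theorem abs_negm {x K : ℝ} (h : |x| ≤ K) : |-x| ≤ K := by rwa [abs_neg]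

/-- `|x| ≤ K_xP`, `|y| ≤ K_yP` ⇒ `|x + y| ≤ (K_x + K_y)P`. [folklore] -/
private theorem abs_add_le_of {x y Kx Ky P : ℝ} (hx : |x| ≤ Kx * P) (hy : |y| ≤ Ky * P) :
    |x + y| ≤ (Kx + Ky) * P := by
  rw [add_mul]; exact (abs_add_le x y).trans (add_le_add hx hy)

/-- `|x| ≤ K_xP`, `|y| ≤ K_yP` ⇒ `|x - y| ≤ (K_x + K_y)P`. [folklore] -/
private theorem abs_sub_le_of {x y Kx Ky P : ℝ} (hx : |x| ≤ Kx * P) (hy : |y| ≤ Ky * P) :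
    |x - y| ≤ (Kx + Ky) * P := by
  rw [add_mul]; exact (abs_sub x y).trans (add_le_add hx hy)

/-- `|c| ≤ K`, `|x| ≤ P` ⇒ `|cx| ≤ KP`. [folklore] -/
private theorem abs_coef_mul {c x K P : ℝ} (hc : |c| ≤ K) (hx : |x| ≤ P) : |c * x| ≤ K * P := by
  rw [abs_mul]; exact mul_le_mul hc hx (abs_nonneg _) ((abs_nonneg c).trans hc)

/-- For `|a|, |b| ≤ 1` and `i + k ≥ 3`: `|a^i b^k| ≤ |a|³ + |b|³`. [folklore] -/
theorem abs_pow_mul_pow_le_cube {a b : ℝ} (ha : |a| ≤ 1) (hb : |b| ≤ 1) {i k : ℕ}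
    (hik : 3 ≤ i + k) : |a ^ i * b ^ k| ≤ |a| ^ 3 + |b| ^ 3 := by
  rw [abs_mul, abs_pow, abs_pow]
  set m := max |a| |b| with hm
  have hm0 : 0 ≤ m := le_max_of_le_left (abs_nonneg a)
  have hm1 : m ≤ 1 := max_le ha hb
  have h1 : |a| ^ i * |b| ^ k ≤ m ^ (i + k) := by
    rw [pow_add]
    exact mul_le_mul (pow_le_pow_left₀ (abs_nonneg a) (le_max_left _ _) i)
      (pow_le_pow_left₀ (abs_nonneg b) (le_max_right _ _) k) (by positivity) (by positivity)
  have h2 : m ^ (i + k) ≤ m ^ 3 := pow_le_pow_of_le_one hm0 hm1 hik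
  have h3 : m ^ 3 ≤ |a| ^ 3 + |b| ^ 3 := by
    rcases le_total |a| |b| with h | h
    · rw [hm, max_eq_right h]; linarith [pow_nonneg (abs_nonneg a) 3]
    · rw [hm, max_eq_left h]; linarith [pow_nonneg (abs_nonneg b) 3]
  exact h1.trans (h2.trans h3)


/-! ### Proposition 5.3.1 -/

/-- **Proposition 5.3.1, `s`-component — the exact conjugation defect.** With `η_j = η_{≥j} -
L^{-(d-α)}η_{≥j+1}` and `L^ε = L^{-(d-α)}L^α` (`ε = 2α - d`), the polynomial
`(T_{j+1}Φ^{(0)}_{pt,j}(ĝ,μ̂))_s - Φ̄_j(T_j(ĝ,μ̂))_s - 4L^ε(L^ε-1)η_{≥j+1}w̄^{(1)}_{j+1} s²`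
(`s = T_j(ĝ,μ̂)_s`) has only terms of degree `≥ 3` in `(ĝ, μ̂)`; the right-hand side lists them
(parameters `r = L^{-(d-α)}`, `Lα = L^α`, `β = β_j`, `γh = γ̂`, `ξ = ξ_j`, `w₀ = w̄_j^{(1)}`,
`w₁ = w̄_{j+1}^{(1)}`, `η₀ = η_{≥j}`, `η₁ = η_{≥j+1}`). This is the computation of the proof of
Proposition 5.3.1 ("For the `ĝ` equation …"), carried to all orders.
[cite: Slade2017, Proposition 5.3.1 and its proof] -/
theorem Slade2017_prop531_fst_eq {Lε Lα r β γh ξ w₀ w₁ η η₀ η₁ : ℝ} (hr : Lε = r * Lα)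
    (hη : η = η₀ - r * η₁) (g μ : ℝ) :
    cvS η₁ w₁ (ptFlowG Lε Lα β η w₀ w₁ g μ) (ptFlowM Lα β γh ξ η w₀ w₁ g μ)
      - barFlowS Lε (betaW β η₀ w₀ η₁ w₁) (cvS η₀ w₀ g μ)
      - 4 * Lε * (Lε - 1) * η₁ * w₁ * cvS η₀ w₀ g μ ^ 2 =
      ((20 : ℝ) * r * Lα * Lα * w₀ * w₁ - (20 : ℝ) * r * Lα * Lα * Lα * w₁ * w₁) * (g * μ ^ 2)
      + ((16 : ℝ) * r * Lα * Lα * w₀ * w₀ * w₁ - (32 : ℝ) * r * Lα * Lα * Lα * w₀ * w₁ * w₁ + (16 : ℝ) * r * Lα * Lα * Lα * Lα * w₁ * w₁ * w₁) * (g * μ ^ 3)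
      + ((32 : ℝ) * r * Lα * w₀ * w₀ * η₀ + (8 : ℝ) * r * Lα * β * w₀ + (32 : ℝ) * r * Lα * Lα * w₀ * w₁ * η₀ - (4 : ℝ) * r * Lα * Lα * β * w₁ - (4 : ℝ) * r * Lα * Lα * β * γh * w₁ - (32 : ℝ) * r * r * Lα * Lα * w₀ * w₁ * η₁ - (40 : ℝ) * r * Lα * Lα * Lα * w₁ * w₁ * η₀ + (8 : ℝ) * r * r * Lα * Lα * Lα * w₁ * w₁ * η₁) * (g ^ 2 * μ)
      + ((64 : ℝ) * r * Lα * w₀ * w₀ * w₀ * η₀ + (16 : ℝ) * r * Lα * β * w₀ * w₀ + (64 : ℝ) * r * Lα * Lα * w₀ * w₀ * w₁ * η₀ - (4 : ℝ) * r * Lα * Lα * β * w₀ * w₁ - (16 : ℝ) * r * Lα * Lα * β * γh * w₀ * w₁ - (64 : ℝ) * r * r * Lα * Lα * w₀ * w₀ * w₁ * η₁ - (112 : ℝ) * r * Lα * Lα * Lα * w₀ * w₁ * w₁ * η₀ + (4 : ℝ) * r * Lα * Lα * Lα * β * w₁ * w₁ + (16 : ℝ) * r * Lα * Lα * Lα *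 β * γh * w₁ * w₁ - (16 : ℝ) * r * r * Lα * Lα * Lα * w₀ * w₁ * w₁ * η₁ + (48 : ℝ) * r * Lα * Lα * Lα * Lα * w₁ * w₁ * w₁ * η₀ + (16 : ℝ) * r * r * Lα * Lα * Lα * Lα * w₁ * w₁ * w₁ * η₁) * (g ^ 2 * μ ^ 2)
      + ((32 : ℝ) * r * Lα * w₀ * w₀ * η₀ * η₀ + (8 : ℝ) * r * Lα * β * w₀ * η₀ - (4 : ℝ) * r * Lα * Lα * ξ * w₁ - (4 : ℝ) * r * Lα * Lα * β * w₁ * η₀ - (32 : ℝ) * r * r * Lα * Lα * w₀ * w₁ * η₀ * η₁ - (4 : ℝ) * r * r * Lα * Lα * β * w₁ * η₁ - (20 : ℝ) * r * Lα * Lα * Lα * w₁ * w₁ * η₀ * η₀ + (8 : ℝ) * r * r * Lα * Lα * Lα * w₁ * w₁ * η₀ * η₁ + (12 : ℝ) * r * r * r * Lα * Lα * Lα * w₁ * w₁ * η₁ * η₁) * (g ^ 3)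
      + ((128 : ℝ) * r * Lα * w₀ * w₀ * w₀ * η₀ * η₀ + (32 : ℝ) * r * Lα * β * w₀ * w₀ * η₀ - (16 : ℝ) * r * Lα * Lα * ξ * w₀ * w₁ - (16 : ℝ) * r * Lα * Lα * β * w₀ * w₁ * η₀ + (4 : ℝ) * r * Lα * Lα * β * β * γh * w₁ - (128 : ℝ) * r * r * Lα * Lα * w₀ * w₀ * w₁ * η₀ * η₁ - (16 : ℝ) * r * r * Lα * Lα * β * w₀ * w₁ * η₁ - (80 : ℝ) * r * Lα * Lα * Lα * w₀ * w₁ * w₁ * η₀ * η₀ + (16 : ℝ) * r * Lα * Lα * Lα * ξ * w₁ * w₁ + (8 : ℝ) * r * Lα * Lα * Lα * β * w₁ * w₁ * η₀ + (16 : ℝ) * r * Lα * Lα * Lα * β * γh * w₁ * w₁ * η₀ + (32 : ℝ) * r * r * Lα * Lα * Lα * w₀ * w₁ * w₁ * η₀ * η₁ + (24 : ℝ) * r * r * Lα * Lα * Lα * β * w₁ * w₁ * η₁ - (16 : ℝ) * r * r * Lα * Lα * Lα * β * γh * w₁ * w₁ * η₁ + (48 : ℝ) * r * r * r * Lα * Lα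 * Lα * w₀ * w₁ * w₁ * η₁ * η₁ + (48 : ℝ) * r * Lα * Lα * Lα * Lα * w₁ * w₁ * w₁ * η₀ * η₀ + (32 : ℝ) * r * r * Lα * Lα * Lα * Lα * w₁ * w₁ * w₁ * η₀ * η₁ - (80 : ℝ) * r * r * r * Lα * Lα * Lα * Lα * w₁ * w₁ * w₁ * η₁ * η₁) * (g ^ 3 * μ)
      + ((64 : ℝ) * r * Lα * w₀ * w₀ * w₀ * η₀ * η₀ * η₀ + (16 : ℝ) * r * Lα * β * w₀ * w₀ * η₀ * η₀ + (4 : ℝ) * r * Lα * Lα * β * ξ * w₁ - (64 : ℝ) * r * r * Lα * Lα * w₀ * w₀ * w₁ * η₀ * η₀ * η₁ + (4 : ℝ) * r * r * Lα * Lα * β * β * w₁ * η₁ + (16 : ℝ) * r * Lα * Lα * Lα * ξ * w₁ * w₁ * η₀ + (4 : ℝ) * r * Lα * Lα * Lα * β * w₁ * w₁ * η₀ * η₀ - (16 : ℝ) * r * r * Lα * Lα * Lα * ξ * w₁ * w₁ * η₁ + (24 : ℝ) * r * r * Lα * Lα * Lα * β * w₁ * w₁ * η₀ * η₁ - (28 :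 ℝ) * r * r * r * Lα * Lα * Lα * β * w₁ * w₁ * η₁ * η₁ + (16 : ℝ) * r * Lα * Lα * Lα * Lα * w₁ * w₁ * w₁ * η₀ * η₀ * η₀ + (16 : ℝ) * r * r * Lα * Lα * Lα * Lα * w₁ * w₁ * w₁ * η₀ * η₀ * η₁ - (80 : ℝ) * r * r * r * Lα * Lα * Lα * Lα * w₁ * w₁ * w₁ * η₀ * η₁ * η₁ + (48 : ℝ) * r * r * r * r * Lα * Lα * Lα * Lα * w₁ * w₁ * w₁ * η₁ * η₁ * η₁) * (g ^ 4) := by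
  subst hr hη
  unfold cvS ptFlowG ptFlowM barFlowS betaW
  ring

/-- **Proposition 5.3.1, `μ`-component — the exact conjugation defect.** Under the same relations,
`(T_{j+1}Φ^{(0)}_{pt,j}(ĝ,μ̂))_μ - Φ̄_j(T_j(ĝ,μ̂))_μ` has only terms of degree `≥ 3` in `(ĝ, μ̂)`
(exact cancellation of all first- and second-order terms: "`T^{(μ)}_{j+1}(ĝ₊,μ̂₊) =
Φ̄_j^{(μ)}(s,μ) + O(x̂³)`"). [cite: Slade2017, Proposition 5.3.1 and its proof] -/
theorem Slade2017_prop531_snd_eq {Lε Lα r β γh ξ w₀ w₁ η η₀ η₁ : ℝ} (hr : Lε = r * Lα)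
    (hη : η = η₀ - r * η₁) (g μ : ℝ) :
    cvM η₁ w₁ (ptFlowG Lε Lα β η w₀ w₁ g μ) (ptFlowM Lα β γh ξ η w₀ w₁ g μ)
      - barFlowM Lα γh β (xiW r β γh ξ η₀ η₁) (cvS η₀ w₀ g μ) (cvM η₀ w₀ g μ) =
      ((2 : ℝ) * Lα * Lα * w₀ * w₁ - (2 : ℝ) * Lα * Lα * Lα * w₁ * w₁) * (μ ^ 3)
      + ((1 : ℝ) * Lα * Lα * w₀ * w₀ * w₁ - (2 : ℝ) * Lα * Lα * Lα * w₀ * w₁ * w₁ + (1 : ℝ) * Lα * Lα * Lα * Lα * w₁ * w₁ * w₁) * (μ ^ 4)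
      + ((5 : ℝ) * Lα * β * γh * w₀ + (10 : ℝ) * Lα * Lα * w₀ * w₁ * η₀ - (2 : ℝ) * Lα * Lα * β * γh * w₁ + (10 : ℝ) * r * Lα * Lα * w₀ * w₁ * η₁ - (6 : ℝ) * Lα * Lα * Lα * w₁ * w₁ * η₀ - (14 : ℝ) * r * Lα * Lα * Lα * w₁ * w₁ * η₁) * (g * μ ^ 2)
      + ((4 : ℝ) * Lα * β * γh * w₀ * w₀ + (8 : ℝ) * Lα * Lα * w₀ * w₀ * w₁ * η₀ - (2 : ℝ) * Lα * Lα * β * γh * w₀ * w₁ + (8 : ℝ) * r * Lα * Lα * w₀ * w₀ * w₁ * η₁ - (12 : ℝ) * Lα * Lα * Lα * w₀ * w₁ * w₁ * η₀ + (2 : ℝ) * Lα * Lα * Lα * β * γh * w₁ * w₁ - (20 : ℝ) * r * Lα * Lα * Lα * w₀ * w₁ * w₁ * η₁ + (4 : ℝ) * Lα * Lα * Lα * Lα * w₁ * w₁ * w₁ * η₀ + (12 : ℝ) * r * Lα * Lα * Lα * Lα * w₁ * w₁ * w₁ * η₁) * (g * μ ^ 3)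
      + ((8 : ℝ) * Lα * ξ * w₀ + (4 : ℝ) * Lα * β * γh * w₀ * η₀ + (8 : ℝ) * r * Lα * β * w₀ * η₁ + (8 : ℝ) * Lα * Lα * w₀ * w₁ * η₀ * η₀ - (2 : ℝ) * Lα * Lα * ξ * w₁ - (2 : ℝ) * Lα * Lα * β * γh * w₁ * η₀ + (16 : ℝ) * r * Lα * Lα * w₀ * w₁ * η₀ * η₁ - (4 : ℝ) * r * Lα * Lα * β * w₁ * η₁ - (2 : ℝ) * r * Lα * Lα * β * γh * w₁ * η₁ - (24 : ℝ) * r * r * Lα * Lα * w₀ * w₁ * η₁ * η₁ - (6 : ℝ) * Lα * Lα * Lα * w₁ * w₁ * η₀ * η₀ - (28 : ℝ) * r * Lα * Lα * Lα * w₁ * w₁ * η₀ * η₁ + (34 : ℝ) * r * r * Lα * Lα * Lα * w₁ * w₁ * η₁ * η₁) * (g ^ 2 * μ)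
      + ((16 : ℝ) * Lα * ξ * w₀ * w₀ + (4 : ℝ) * Lα * β * γh * w₀ * w₀ * η₀ + (16 : ℝ) * r * Lα * β * w₀ * w₀ * η₁ + (16 : ℝ) * Lα * Lα * w₀ * w₀ * w₁ * η₀ * η₀ - (2 : ℝ) * Lα * Lα * ξ * w₀ * w₁ - (8 : ℝ) * Lα * Lα * β * γh * w₀ * w₁ * η₀ + (1 : ℝ) * Lα * Lα * β * β * γh * γh * w₁ + (32 : ℝ) * r * Lα * Lα * w₀ * w₀ * w₁ * η₀ * η₁ - (4 : ℝ) * r * Lα * Lα * β * w₀ * w₁ * η₁ - (8 : ℝ) * r * Lα * Lα * β * γh * w₀ * w₁ * η₁ - (48 : ℝ) * r * r * Lα * Lα * w₀ * w₀ * w₁ * η₁ * η₁ - (18 : ℝ) * Lα * Lα * Lα * w₀ * w₁ * w₁ * η₀ * η₀ + (2 : ℝ) * Lα * Lα * Lα * ξ * w₁ * w₁ + (4 : ℝ) * Lα * Lα * Lα * β * γh * w₁ * w₁ * η₀ - (76 : ℝ) * r * Lα * Lα * Lα * w₀ * w₁ * w₁ * η₀ * η₁ + (4 : ℝ) * r *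 Lα * Lα * Lα * β * w₁ * w₁ * η₁ + (12 : ℝ) * r * Lα * Lα * Lα * β * γh * w₁ * w₁ * η₁ + (94 : ℝ) * r * r * Lα * Lα * Lα * w₀ * w₁ * w₁ * η₁ * η₁ + (6 : ℝ) * Lα * Lα * Lα * Lα * w₁ * w₁ * w₁ * η₀ * η₀ + (36 : ℝ) * r * Lα * Lα * Lα * Lα * w₁ * w₁ * w₁ * η₀ * η₁ - (42 : ℝ) * r * r * Lα * Lα * Lα * Lα * w₁ * w₁ * w₁ * η₁ * η₁) * (g ^ 2 * μ ^ 2)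
      + ((8 : ℝ) * Lα * ξ * w₀ * η₀ - (4 : ℝ) * Lα * β * γh * w₀ * η₀ * η₀ + (8 : ℝ) * r * Lα * β * w₀ * η₀ * η₁ - (2 : ℝ) * Lα * Lα * ξ * w₁ * η₀ - (2 : ℝ) * r * Lα * Lα * ξ * w₁ * η₁ - (4 : ℝ) * r * Lα * Lα * β * w₁ * η₀ * η₁ + (4 : ℝ) * r * r * Lα * Lα * β * w₁ * η₁ * η₁ - (2 : ℝ) * Lα * Lα * Lα * w₁ * w₁ * η₀ * η₀ * η₀ - (14 : ℝ) * r * Lα * Lα * Lα * w₁ * w₁ * η₀ * η₀ * η₁ + (34 : ℝ) * r * r * Lα * Lα * Lα * w₁ * w₁ * η₀ * η₁ * η₁ - (18 : ℝ) * r * r * r * Lα * Lα * Lα * w₁ * w₁ * η₁ * η₁ * η₁) * (g ^ 3)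
      + ((32 : ℝ) * Lα * ξ * w₀ * w₀ * η₀ - (16 : ℝ) * Lα * β * γh * w₀ * w₀ * η₀ * η₀ + (32 : ℝ) * r * Lα * β * w₀ * w₀ * η₀ * η₁ - (8 : ℝ) * Lα * Lα * ξ * w₀ * w₁ * η₀ + (2 : ℝ) * Lα * Lα * β * γh * ξ * w₁ - (8 : ℝ) * r * Lα * Lα * ξ * w₀ * w₁ * η₁ - (16 : ℝ) * r * Lα * Lα * β * w₀ * w₁ * η₀ * η₁ + (4 : ℝ) * r * Lα * Lα * β * β * γh * w₁ * η₁ + (16 : ℝ) * r * r * Lα * Lα * β * w₀ * w₁ * η₁ * η₁ - (8 : ℝ) * Lα * Lα * Lα * w₀ * w₁ * w₁ * η₀ * η₀ * η₀ + (4 : ℝ) * Lα * Lα * Lα * ξ * w₁ * w₁ * η₀ + (2 : ℝ) * Lα * Lα * Lα * β * γh * w₁ * w₁ * η₀ * η₀ - (56 : ℝ) * r * Lα * Lα * Lα * w₀ * w₁ * w₁ * η₀ * η₀ * η₁ + (12 : ℝ) * r * Lα * Lα * Lα * ξ * w₁ * w₁ * η₁ + (8 : ℝ) * r * Lα * Lα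 * Lα * β * w₁ * w₁ * η₀ * η₁ + (12 : ℝ) * r * Lα * Lα * Lα * β * γh * w₁ * w₁ * η₀ * η₁ + (136 : ℝ) * r * r * Lα * Lα * Lα * w₀ * w₁ * w₁ * η₀ * η₁ * η₁ - (8 : ℝ) * r * r * Lα * Lα * Lα * β * w₁ * w₁ * η₁ * η₁ - (14 : ℝ) * r * r * Lα * Lα * Lα * β * γh * w₁ * w₁ * η₁ * η₁ - (72 : ℝ) * r * r * r * Lα * Lα * Lα * w₀ * w₁ * w₁ * η₁ * η₁ * η₁ + (4 : ℝ) * Lα * Lα * Lα * Lα * w₁ * w₁ * w₁ * η₀ * η₀ * η₀ + (36 : ℝ) * r * Lα * Lα * Lα * Lα * w₁ * w₁ * w₁ * η₀ * η₀ * η₁ - (84 : ℝ) * r * r * Lα * Lα * Lα * Lα * w₁ * w₁ * w₁ * η₀ * η₁ * η₁ + (44 : ℝ) * r * r * r * Lα * Lα * Lα * Lα * w₁ * w₁ * w₁ * η₁ * η₁ * η₁) * (g ^ 3 * μ)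
      + ((16 : ℝ) * Lα * ξ * w₀ * w₀ * η₀ * η₀ - (16 : ℝ) * Lα * β * γh * w₀ * w₀ * η₀ * η₀ * η₀ + (16 : ℝ) * r * Lα * β * w₀ * w₀ * η₀ * η₀ * η₁ + (1 : ℝ) * Lα * Lα * ξ * ξ * w₁ + (4 : ℝ) * r * Lα * Lα * β * ξ * w₁ * η₁ + (2 : ℝ) * Lα * Lα * Lα * ξ * w₁ * w₁ * η₀ * η₀ + (12 : ℝ) * r * Lα * Lα * Lα * ξ * w₁ * w₁ * η₀ * η₁ + (4 : ℝ) * r * Lα * Lα * Lα * β * w₁ * w₁ * η₀ * η₀ * η₁ - (14 : ℝ) * r * r * Lα * Lα * Lα * ξ * w₁ * w₁ * η₁ * η₁ - (8 : ℝ) * r * r * Lα * Lα * Lα * β * w₁ * w₁ * η₀ * η₁ * η₁ + (4 : ℝ) * r * r * r * Lα * Lα * Lα * β * w₁ * w₁ * η₁ * η₁ * η₁ + (1 : ℝ) * Lα * Lα * Lα * Lα * w₁ * w₁ * w₁ * η₀ * η₀ * η₀ * η₀ + (12 : ℝ) * r * Lα * Lα * Lα * Lα * w₁ * w₁ * w₁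 * η₀ * η₀ * η₀ * η₁ - (42 : ℝ) * r * r * Lα * Lα * Lα * Lα * w₁ * w₁ * w₁ * η₀ * η₀ * η₁ * η₁ + (44 : ℝ) * r * r * r * Lα * Lα * Lα * Lα * w₁ * w₁ * w₁ * η₀ * η₁ * η₁ * η₁ - (15 : ℝ) * r * r * r * r * Lα * Lα * Lα * Lα * w₁ * w₁ * w₁ * η₁ * η₁ * η₁ * η₁) * (g ^ 4) := by
  subst hr hη
  unfold cvS cvM ptFlowG ptFlowM barFlowM xiW
  ring

/-- **Proposition 5.3.1 (Slade), `s`-component, with explicit constants.** Let `B ≥ 1` bound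
`|L^α|, |β_j|, |γ̂|, |ξ_j|, |w̄_j^{(1)}|, |w̄_{j+1}^{(1)}|, |η_{≥j}|, |η_{≥j+1}|`, let
`0 ≤ L^{-(d-α)} ≤ 1` (`|r| ≤ 1`), `L^ε = L^{-(d-α)}L^α`, `η_j = η_{≥j} - L^{-(d-α)}η_{≥j+1}`. Then
for `|ĝ|, |μ̂| ≤ 1`,
`|(T_{j+1}Φ^{(0)}_{pt,j}(ĝ,μ̂))_s - Φ̄_j(T_j(ĝ,μ̂))_s - 4L^ε(L^ε-1)η_{≥j+1}w̄^{(1)}_{j+1}s²|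
≤ 1968·B^{10}(|ĝ|³ + |μ̂|³)`, `s = T_j(ĝ,μ̂)_s`: the `s`-component of
"`T_{j+1} ∘ Φ^{(0)}_{pt,j} ∘ T_j⁻¹ = Φ̄_j + e_{pt,j}`, `e_{pt,j}(s,μ) = O(|s|³ + |s|²ε + |μ|³)` with
constant uniform in `m² ∈ [0,m̄²]` and `j ≤ j_m`" (the uniformity being that of the coefficient
bounds, Lemma 5.2.1, and `0 ≤ L^ε - 1 ≤ εL^ε log L`, `rpow_sub_one_le`), before composition with
`T_j⁻¹`. [cite: Slade2017, Proposition 5.3.1] -/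
theorem Slade2017_prop531_fst {Lε Lα r β γh ξ w₀ w₁ η η₀ η₁ B : ℝ} (hr : Lε = r * Lα)
    (hη : η = η₀ - r * η₁) (hB : 1 ≤ B) (hLα : |Lα| ≤ B) (hr1 : |r| ≤ 1) (hβ : |β| ≤ B)
    (hγ : |γh| ≤ B) (hξ : |ξ| ≤ B) (hw₀ : |w₀| ≤ B) (hw₁ : |w₁| ≤ B) (hη₀ : |η₀| ≤ B)
    (hη₁ : |η₁| ≤ B) {g μ : ℝ} (hg : |g| ≤ 1) (hμ : |μ| ≤ 1) :
    |cvS η₁ w₁ (ptFlowG Lε Lα β η w₀ w₁ g μ) (ptFlowM Lα β γh ξ η w₀ w₁ g μ)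
      - barFlowS Lε (betaW β η₀ w₀ η₁ w₁) (cvS η₀ w₀ g μ)
      - 4 * Lε * (Lε - 1) * η₁ * w₁ * cvS η₀ w₀ g μ ^ 2|
      ≤ 1968 * B ^ 10 * (|g| ^ 3 + |μ| ^ 3) := by
  rw [Slade2017_prop531_fst_eq hr hη]
  have hc0 : |(20 : ℝ) * r * Lα * Lα * w₀ * w₁ - (20 : ℝ) * r * Lα * Lα * Lα * w₁ * w₁| ≤ (40 : ℝ) * B ^ 10 := by
    refine le_of_le_of_eq (abs_sub_le_of (abs_top hB (by norm_num) (by norm_num : 4 ≤ 10) (abs_step (abs_step (abs_step (abs_step (abs_step1 (abs_base (by norm_num : (0:ℝ) ≤ 20)) hr1) hLα) hLα) hw₀) hw₁)) (abs_top hB (by norm_num) (by norm_num : 5 ≤ 10) (abs_step (abs_step (abs_step (abs_step (abs_step (abs_step1 (abs_base (by norm_num : (0:ℝ) ≤ 20)) hr1) hLα) hLα) hLα) hw₁) hw₁))) ?_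
    norm_num
  have hx0 : |g * μ ^ 2| ≤ |g| ^ 3 + |μ| ^ 3 := by
    simpa using abs_pow_mul_pow_le_cube hg hμ (i := 1) (k := 2) (by norm_num)
  have ht0 : |((20 : ℝ) * r * Lα * Lα * w₀ * w₁ - (20 : ℝ) * r * Lα * Lα * Lα * w₁ * w₁) * (g * μ ^ 2)| ≤ (40 : ℝ) * B ^ 10 * (|g| ^ 3 + |μ| ^ 3) := abs_coef_mul hc0 hx0
  have hc1 : |(16 : ℝ) * r * Lα * Lα * w₀ * w₀ * w₁ - (32 : ℝ) * r * Lα * Lα * Lα * w₀ * w₁ * w₁ + (16 : ℝ) * r * Lα * Lα * Lα * Lα * w₁ * w₁ * w₁| ≤ (64 : ℝ) * B ^ 10 := by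
    refine le_of_le_of_eq (abs_add_le_of (abs_sub_le_of (abs_top hB (by norm_num) (by norm_num : 5 ≤ 10) (abs_step (abs_step (abs_step (abs_step (abs_step (abs_step1 (abs_base (by norm_num : (0:ℝ) ≤ 16)) hr1) hLα) hLα) hw₀) hw₀) hw₁)) (abs_top hB (by norm_num) (by norm_num : 6 ≤ 10) (abs_step (abs_step (abs_step (abs_step (abs_step (abs_step (abs_step1 (abs_base (by norm_num : (0:ℝ) ≤ 32)) hr1) hLα) hLα) hLα) hw₀) hw₁) hw₁))) (abs_top hB (by norm_num) (by norm_num : 7 ≤ 10) (abs_step (abs_step (abs_step (abs_step (abs_step (abs_step (abs_step (abs_step1 (abs_base (by norm_num : (0:ℝ) ≤ 16)) hr1) hLα) hLα) hLα) hLα) hw₁) hw₁) hw₁))) ?_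
    norm_num
  have hx1 : |g * μ ^ 3| ≤ |g| ^ 3 + |μ| ^ 3 := by
    simpa using abs_pow_mul_pow_le_cube hg hμ (i := 1) (k := 3) (by norm_num)
  have ht1 : |((16 : ℝ) * r * Lα * Lα * w₀ * w₀ * w₁ - (32 : ℝ) * r * Lα * Lα * Lα * w₀ * w₁ * w₁ + (16 : ℝ) * r * Lα * Lα * Lα * Lα * w₁ * w₁ * w₁) * (g * μ ^ 3)| ≤ (64 : ℝ) * B ^ 10 * (|g| ^ 3 + |μ| ^ 3) := abs_coef_mul hc1 hx1
  have hc2 : |(32 : ℝ) * r * Lα * w₀ * w₀ * η₀ + (8 : ℝ) * r * Lα * β * w₀ + (32 : ℝ) * r * Lα * Lα * w₀ * w₁ * η₀ - (4 : ℝ) * r * Lα * Lα * β * w₁ - (4 : ℝ) * r * Lα * Lα * β * γh * w₁ - (32 : ℝ) * r * r * Lα * Lα * w₀ * w₁ * η₁ - (40 : ℝ) * r * Lα * Lα * Lα * w₁ * w₁ * η₀ + (8 : ℝ) * r * r * Lα * Lα * Lα * w₁ * w₁ * η₁| ≤ (160 : ℝ) * B ^ 10 := by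
    refine le_of_le_of_eq (abs_add_le_of (abs_sub_le_of (abs_sub_le_of (abs_sub_le_of (abs_sub_le_of (abs_add_le_of (abs_add_le_of (abs_top hB (by norm_num) (by norm_num : 4 ≤ 10) (abs_step (abs_step (abs_step (abs_step (abs_step1 (abs_base (by norm_num : (0:ℝ) ≤ 32)) hr1) hLα) hw₀) hw₀) hη₀)) (abs_top hB (by norm_num) (by norm_num : 3 ≤ 10) (abs_step (abs_step (abs_step (abs_step1 (abs_base (by norm_num : (0:ℝ) ≤ 8)) hr1) hLα) hβ) hw₀))) (abs_top hB (by norm_num) (by norm_num : 5 ≤ 10) (abs_step (abs_step (abs_step (abs_step (abs_step (abs_step1 (abs_base (by norm_num : (0:ℝ) ≤ 32)) hr1) hLα) hLα) hw₀) hw₁) hη₀))) (abs_top hB (by norm_num) (by norm_num : 4 ≤ 10) (abs_step (abs_step (abs_step (abs_step (abs_step1 (abs_base (by norm_num : (0:ℝ) ≤ 4)) hr1) hLα) hLα) hβ) hw₁))) (abs_top hB (by norm_num) (by norm_num : 5 ≤ 10) (abs_step (abs_step (abs_step (abs_step (abs_step (abs_step1 (abs_base (by norm_num : (0:ℝ)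 ≤ 4)) hr1) hLα) hLα) hβ) hγ) hw₁))) (abs_top hB (by norm_num) (by norm_num : 5 ≤ 10) (abs_step (abs_step (abs_step (abs_step (abs_step (abs_step1 (abs_step1 (abs_base (by norm_num : (0:ℝ) ≤ 32)) hr1) hr1) hLα) hLα) hw₀) hw₁) hη₁))) (abs_top hB (by norm_num) (by norm_num : 6 ≤ 10) (abs_step (abs_step (abs_step (abs_step (abs_step (abs_step (abs_step1 (abs_base (by norm_num : (0:ℝ) ≤ 40)) hr1) hLα) hLα) hLα) hw₁) hw₁) hη₀))) (abs_top hB (by norm_num) (by norm_num : 6 ≤ 10) (abs_step (abs_step (abs_step (abs_step (abs_step (abs_step (abs_step1 (abs_step1 (abs_base (by norm_num : (0:ℝ) ≤ 8)) hr1) hr1) hLα) hLα) hLα) hw₁) hw₁) hη₁))) ?_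
    norm_num
  have hx2 : |g ^ 2 * μ| ≤ |g| ^ 3 + |μ| ^ 3 := by
    simpa using abs_pow_mul_pow_le_cube hg hμ (i := 2) (k := 1) (by norm_num)
  have ht2 : |((32 : ℝ) * r * Lα * w₀ * w₀ * η₀ + (8 : ℝ) * r * Lα * β * w₀ + (32 : ℝ) * r * Lα * Lα * w₀ * w₁ * η₀ - (4 : ℝ) * r * Lα * Lα * β * w₁ - (4 : ℝ) * r * Lα * Lα * β * γh * w₁ - (32 : ℝ) * r * r * Lα * Lα * w₀ * w₁ * η₁ - (40 : ℝ) * r * Lα * Lα * Lα * w₁ * w₁ * η₀ + (8 : ℝ) * r * r * Lα * Lα * Lα * w₁ * w₁ * η₁) * (g ^ 2 * μ)| ≤ (160 : ℝ) * B ^ 10 * (|g| ^ 3 + |μ| ^ 3) := abs_coef_mul hc2 hx2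
  have hc3 : |(64 : ℝ) * r * Lα * w₀ * w₀ * w₀ * η₀ + (16 : ℝ) * r * Lα * β * w₀ * w₀ + (64 : ℝ) * r * Lα * Lα * w₀ * w₀ * w₁ * η₀ - (4 : ℝ) * r * Lα * Lα * β * w₀ * w₁ - (16 : ℝ) * r * Lα * Lα * β * γh * w₀ * w₁ - (64 : ℝ) * r * r * Lα * Lα * w₀ * w₀ * w₁ * η₁ - (112 : ℝ) * r * Lα * Lα * Lα * w₀ * w₁ * w₁ * η₀ + (4 : ℝ) * r * Lα * Lα * Lα * β * w₁ * w₁ + (16 : ℝ) * r * Lα * Lα * Lα * β * γh * w₁ * w₁ - (16 : ℝ) * r * r * Lα * Lα * Lα * w₀ * w₁ * w₁ * η₁ + (48 : ℝ) * r * Lα * Lα * Lα * Lα * w₁ * w₁ * w₁ * η₀ + (16 : ℝ) * r * r * Lα * Lα * Lα * Lα * w₁ * w₁ * w₁ * η₁| ≤ (440 : ℝ) * B ^ 10 := by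
    refine le_of_le_of_eq (abs_add_le_of (abs_add_le_of (abs_sub_le_of (abs_add_le_of (abs_add_le_of (abs_sub_le_of (abs_sub_le_of (abs_sub_le_of (abs_sub_le_of (abs_add_le_of (abs_add_le_of (abs_top hB (by norm_num) (by norm_num : 5 ≤ 10) (abs_step (abs_step (abs_step (abs_step (abs_step (abs_step1 (abs_base (by norm_num : (0:ℝ) ≤ 64)) hr1) hLα) hw₀) hw₀) hw₀) hη₀)) (abs_top hB (by norm_num) (by norm_num : 4 ≤ 10) (abs_step (abs_step (abs_step (abs_step (abs_step1 (abs_base (by norm_num : (0:ℝ) ≤ 16)) hr1) hLα) hβ) hw₀) hw₀))) (abs_top hB (by norm_num) (by norm_num : 6 ≤ 10) (abs_step (abs_step (abs_step (abs_step (abs_step (abs_step (abs_step1 (abs_base (by norm_num : (0:ℝ) ≤ 64)) hr1) hLα) hLα) hw₀) hw₀) hw₁) hη₀))) (abs_top hB (by norm_num) (by norm_num : 5 ≤ 10) (abs_step (abs_step (abs_step (abs_step (abs_step (abs_step1 (abs_base (by norm_num : (0:ℝ) ≤ 4)) hr1) hLα) hLα) hβ) hw₀) hw₁))) (abs_top hB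 (by norm_num) (by norm_num : 6 ≤ 10) (abs_step (abs_step (abs_step (abs_step (abs_step (abs_step (abs_step1 (abs_base (by norm_num : (0:ℝ) ≤ 16)) hr1) hLα) hLα) hβ) hγ) hw₀) hw₁))) (abs_top hB (by norm_num) (by norm_num : 6 ≤ 10) (abs_step (abs_step (abs_step (abs_step (abs_step (abs_step (abs_step1 (abs_step1 (abs_base (by norm_num : (0:ℝ) ≤ 64)) hr1) hr1) hLα) hLα) hw₀) hw₀) hw₁) hη₁))) (abs_top hB (by norm_num) (by norm_num : 7 ≤ 10) (abs_step (abs_step (abs_step (abs_step (abs_step (abs_step (abs_step (abs_step1 (abs_base (by norm_num : (0:ℝ) ≤ 112)) hr1) hLα) hLα) hLα) hw₀) hw₁) hw₁) hη₀))) (abs_top hB (by norm_num) (by norm_num : 6 ≤ 10) (abs_step (abs_step (abs_step (abs_step (abs_step (abs_step (abs_step1 (abs_base (by norm_num : (0:ℝ) ≤ 4)) hr1) hLα) hLα) hLα) hβ) hw₁) hw₁))) (abs_top hB (by norm_num) (by norm_num : 7 ≤ 10) (abs_step (abs_step (abs_step (abs_step (abs_step (abs_step (abs_step (abs_step1 (abs_base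 (by norm_num : (0:ℝ) ≤ 16)) hr1) hLα) hLα) hLα) hβ) hγ) hw₁) hw₁))) (abs_top hB (by norm_num) (by norm_num : 7 ≤ 10) (abs_step (abs_step (abs_step (abs_step (abs_step (abs_step (abs_step (abs_step1 (abs_step1 (abs_base (by norm_num : (0:ℝ) ≤ 16)) hr1) hr1) hLα) hLα) hLα) hw₀) hw₁) hw₁) hη₁))) (abs_top hB (by norm_num) (by norm_num : 8 ≤ 10) (abs_step (abs_step (abs_step (abs_step (abs_step (abs_step (abs_step (abs_step (abs_step1 (abs_base (by norm_num : (0:ℝ) ≤ 48)) hr1) hLα) hLα) hLα) hLα) hw₁) hw₁) hw₁) hη₀))) (abs_top hB (by norm_num) (by norm_num : 8 ≤ 10) (abs_step (abs_step (abs_step (abs_step (abs_step (abs_step (abs_step (abs_step (abs_step1 (abs_step1 (abs_base (by norm_num : (0:ℝ) ≤ 16)) hr1) hr1) hLα) hLα) hLα) hLα) hw₁) hw₁) hw₁) hη₁))) ?_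
    norm_num
  have hx3 : |g ^ 2 * μ ^ 2| ≤ |g| ^ 3 + |μ| ^ 3 := by
    simpa using abs_pow_mul_pow_le_cube hg hμ (i := 2) (k := 2) (by norm_num)
  have ht3 : |((64 : ℝ) * r * Lα * w₀ * w₀ * w₀ * η₀ + (16 : ℝ) * r * Lα * β * w₀ * w₀ + (64 : ℝ) * r * Lα * Lα * w₀ * w₀ * w₁ * η₀ - (4 : ℝ) * r * Lα * Lα * β * w₀ * w₁ - (16 : ℝ) * r * Lα * Lα * β * γh * w₀ * w₁ - (64 : ℝ) * r * r * Lα * Lα * w₀ * w₀ * w₁ * η₁ - (112 : ℝ) * r * Lα * Lα * Lα * w₀ * w₁ * w₁ * η₀ + (4 : ℝ) * r * Lα * Lα * Lα * β * w₁ * w₁ + (16 : ℝ) * r * Lα * Lα * Lα * β * γh * w₁ * w₁ - (16 : ℝ) * r * r * Lα * Lα * Lα * w₀ * w₁ * w₁ * η₁ + (48 : ℝ) * r * Lα * Lα * Lα * Lα * w₁ * w₁ * w₁ * η₀ + (16 : ℝ) * r * r * Lα * Lα * Lα * Lα * w₁ * w₁ * w₁ * η₁) * (g ^ 2 * μ ^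 2)| ≤ (440 : ℝ) * B ^ 10 * (|g| ^ 3 + |μ| ^ 3) := abs_coef_mul hc3 hx3
  have hc4 : |(32 : ℝ) * r * Lα * w₀ * w₀ * η₀ * η₀ + (8 : ℝ) * r * Lα * β * w₀ * η₀ - (4 : ℝ) * r * Lα * Lα * ξ * w₁ - (4 : ℝ) * r * Lα * Lα * β * w₁ * η₀ - (32 : ℝ) * r * r * Lα * Lα * w₀ * w₁ * η₀ * η₁ - (4 : ℝ) * r * r * Lα * Lα * β * w₁ * η₁ - (20 : ℝ) * r * Lα * Lα * Lα * w₁ * w₁ * η₀ * η₀ + (8 : ℝ) * r * r * Lα * Lα * Lα * w₁ * w₁ * η₀ * η₁ + (12 : ℝ) * r * r * r * Lα * Lα * Lα * w₁ * w₁ * η₁ * η₁| ≤ (124 : ℝ) * B ^ 10 := by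
    refine le_of_le_of_eq (abs_add_le_of (abs_add_le_of (abs_sub_le_of (abs_sub_le_of (abs_sub_le_of (abs_sub_le_of (abs_sub_le_of (abs_add_le_of (abs_top hB (by norm_num) (by norm_num : 5 ≤ 10) (abs_step (abs_step (abs_step (abs_step (abs_step (abs_step1 (abs_base (by norm_num : (0:ℝ) ≤ 32)) hr1) hLα) hw₀) hw₀) hη₀) hη₀)) (abs_top hB (by norm_num) (by norm_num : 4 ≤ 10) (abs_step (abs_step (abs_step (abs_step (abs_step1 (abs_base (by norm_num : (0:ℝ) ≤ 8)) hr1) hLα) hβ) hw₀) hη₀))) (abs_top hB (by norm_num) (by norm_num : 4 ≤ 10) (abs_step (abs_step (abs_step (abs_step (abs_step1 (abs_base (by norm_num : (0:ℝ) ≤ 4)) hr1) hLα) hLα) hξ) hw₁))) (abs_top hB (by norm_num) (by norm_num : 5 ≤ 10) (abs_step (abs_step (abs_step (abs_step (abs_step (abs_step1 (abs_base (by norm_num : (0:ℝ) ≤ 4)) hr1) hLα) hLα) hβ) hw₁) hη₀))) (abs_top hB (by norm_num) (by norm_num : 6 ≤ 10) (abs_step (abs_step (abs_step (abs_step (abs_step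 (abs_step (abs_step1 (abs_step1 (abs_base (by norm_num : (0:ℝ) ≤ 32)) hr1) hr1) hLα) hLα) hw₀) hw₁) hη₀) hη₁))) (abs_top hB (by norm_num) (by norm_num : 5 ≤ 10) (abs_step (abs_step (abs_step (abs_step (abs_step (abs_step1 (abs_step1 (abs_base (by norm_num : (0:ℝ) ≤ 4)) hr1) hr1) hLα) hLα) hβ) hw₁) hη₁))) (abs_top hB (by norm_num) (by norm_num : 7 ≤ 10) (abs_step (abs_step (abs_step (abs_step (abs_step (abs_step (abs_step (abs_step1 (abs_base (by norm_num : (0:ℝ) ≤ 20)) hr1) hLα) hLα) hLα) hw₁) hw₁) hη₀) hη₀))) (abs_top hB (by norm_num) (by norm_num : 7 ≤ 10) (abs_step (abs_step (abs_step (abs_step (abs_step (abs_step (abs_step (abs_step1 (abs_step1 (abs_base (by norm_num : (0:ℝ) ≤ 8)) hr1) hr1) hLα) hLα) hLα) hw₁) hw₁) hη₀) hη₁))) (abs_top hB (by norm_num) (by norm_num : 7 ≤ 10) (abs_step (abs_step (abs_step (abs_step (abs_step (abs_step (abs_step (abs_step1 (abs_step1 (abs_step1 (abs_base (by norm_num :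 (0:ℝ) ≤ 12)) hr1) hr1) hr1) hLα) hLα) hLα) hw₁) hw₁) hη₁) hη₁))) ?_
    norm_num
  have hx4 : |g ^ 3| ≤ |g| ^ 3 + |μ| ^ 3 := by
    rw [abs_pow]; linarith [pow_nonneg (abs_nonneg μ) 3]
  have ht4 : |((32 : ℝ) * r * Lα * w₀ * w₀ * η₀ * η₀ + (8 : ℝ) * r * Lα * β * w₀ * η₀ - (4 : ℝ) * r * Lα * Lα * ξ * w₁ - (4 : ℝ) * r * Lα * Lα * β * w₁ * η₀ - (32 : ℝ) * r * r * Lα * Lα * w₀ * w₁ * η₀ * η₁ - (4 : ℝ) * r * r * Lα * Lα * β * w₁ * η₁ - (20 : ℝ) * r * Lα * Lα * Lα * w₁ * w₁ * η₀ * η₀ + (8 : ℝ) * r * r * Lα * Lα * Lα * w₁ * w₁ * η₀ * η₁ + (12 : ℝ) * r * r * r * Lα * Lα * Lα * w₁ * w₁ * η₁ * η₁) * (g ^ 3)| ≤ (124 : ℝ) * B ^ 10 * (|g| ^ 3 + |μ| ^ 3) := abs_coef_mul hc4 hx4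
  have hc5 : |(128 : ℝ) * r * Lα * w₀ * w₀ * w₀ * η₀ * η₀ + (32 : ℝ) * r * Lα * β * w₀ * w₀ * η₀ - (16 : ℝ) * r * Lα * Lα * ξ * w₀ * w₁ - (16 : ℝ) * r * Lα * Lα * β * w₀ * w₁ * η₀ + (4 : ℝ) * r * Lα * Lα * β * β * γh * w₁ - (128 : ℝ) * r * r * Lα * Lα * w₀ * w₀ * w₁ * η₀ * η₁ - (16 : ℝ) * r * r * Lα * Lα * β * w₀ * w₁ * η₁ - (80 : ℝ) * r * Lα * Lα * Lα * w₀ * w₁ * w₁ * η₀ * η₀ + (16 : ℝ) * r * Lα * Lα * Lα * ξ * w₁ * w₁ + (8 : ℝ) * r * Lα * Lα * Lα * β * w₁ * w₁ * η₀ + (16 : ℝ) * r * Lα * Lα * Lα * β * γh * w₁ * w₁ * η₀ + (32 : ℝ) * r * r * Lα * Lα * Lα * w₀ * w₁ * w₁ * η₀ * η₁ + (24 : ℝ) * r * r * Lα * Lα * Lα * β * w₁ * w₁ * η₁ - (16 : ℝ) * r * r * Lα * Lα * Lα * β * γh * w₁ * w₁ * η₁ + (48 : ℝ) * r * r * r *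 Lα * Lα * Lα * w₀ * w₁ * w₁ * η₁ * η₁ + (48 : ℝ) * r * Lα * Lα * Lα * Lα * w₁ * w₁ * w₁ * η₀ * η₀ + (32 : ℝ) * r * r * Lα * Lα * Lα * Lα * w₁ * w₁ * w₁ * η₀ * η₁ - (80 : ℝ) * r * r * r * Lα * Lα * Lα * Lα * w₁ * w₁ * w₁ * η₁ * η₁| ≤ (740 : ℝ) * B ^ 10 := by
    refine le_of_le_of_eq (abs_sub_le_of (abs_add_le_of (abs_add_le_of (abs_add_le_of (abs_sub_le_of (abs_add_le_of (abs_add_le_of (abs_add_le_of (abs_add_le_of (abs_add_le_of (abs_sub_le_of (abs_sub_le_of (abs_sub_le_of (abs_add_le_of (abs_sub_le_of (abs_sub_le_of (abs_add_le_of (abs_top hB (by norm_num) (by norm_num : 6 ≤ 10) (abs_step (abs_step (abs_step (abs_step (abs_step (abs_step (abs_step1 (abs_base (by norm_num : (0:ℝ) ≤ 128)) hr1) hLα) hw₀) hw₀) hw₀) hη₀) hη₀)) (abs_top hB (by norm_num) (by norm_num : 5 ≤ 10) (abs_step (abs_step (abs_step (abs_step (abs_step (abs_step1 (abs_base (by norm_num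 : (0:ℝ) ≤ 32)) hr1) hLα) hβ) hw₀) hw₀) hη₀))) (abs_top hB (by norm_num) (by norm_num : 5 ≤ 10) (abs_step (abs_step (abs_step (abs_step (abs_step (abs_step1 (abs_base (by norm_num : (0:ℝ) ≤ 16)) hr1) hLα) hLα) hξ) hw₀) hw₁))) (abs_top hB (by norm_num) (by norm_num : 6 ≤ 10) (abs_step (abs_step (abs_step (abs_step (abs_step (abs_step (abs_step1 (abs_base (by norm_num : (0:ℝ) ≤ 16)) hr1) hLα) hLα) hβ) hw₀) hw₁) hη₀))) (abs_top hB (by norm_num) (by norm_num : 6 ≤ 10) (abs_step (abs_step (abs_step (abs_step (abs_step (abs_step (abs_step1 (abs_base (by norm_num : (0:ℝ) ≤ 4)) hr1) hLα) hLα) hβ) hβ) hγ) hw₁))) (abs_top hB (by norm_num) (by norm_num : 7 ≤ 10) (abs_step (abs_step (abs_step (abs_step (abs_step (abs_step (abs_step (abs_step1 (abs_step1 (abs_base (by norm_num : (0:ℝ) ≤ 128)) hr1) hr1) hLα) hLα) hw₀) hw₀) hw₁) hη₀) hη₁))) (abs_top hB (by norm_num) (by norm_num : 6 ≤ 10) (abs_step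 (abs_step (abs_step (abs_step (abs_step (abs_step (abs_step1 (abs_step1 (abs_base (by norm_num : (0:ℝ) ≤ 16)) hr1) hr1) hLα) hLα) hβ) hw₀) hw₁) hη₁))) (abs_top hB (by norm_num) (by norm_num : 8 ≤ 10) (abs_step (abs_step (abs_step (abs_step (abs_step (abs_step (abs_step (abs_step (abs_step1 (abs_base (by norm_num : (0:ℝ) ≤ 80)) hr1) hLα) hLα) hLα) hw₀) hw₁) hw₁) hη₀) hη₀))) (abs_top hB (by norm_num) (by norm_num : 6 ≤ 10) (abs_step (abs_step (abs_step (abs_step (abs_step (abs_step (abs_step1 (abs_base (by norm_num : (0:ℝ) ≤ 16)) hr1) hLα) hLα) hLα) hξ) hw₁) hw₁))) (abs_top hB (by norm_num) (by norm_num : 7 ≤ 10) (abs_step (abs_step (abs_step (abs_step (abs_step (abs_step (abs_step (abs_step1 (abs_base (by norm_num : (0:ℝ) ≤ 8)) hr1) hLα) hLα) hLα) hβ) hw₁) hw₁) hη₀))) (abs_top hB (by norm_num) (by norm_num : 8 ≤ 10) (abs_step (abs_step (abs_step (abs_step (abs_step (abs_step (abs_step (abs_step (abs_step1 (abs_base (by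 norm_num : (0:ℝ) ≤ 16)) hr1) hLα) hLα) hLα) hβ) hγ) hw₁) hw₁) hη₀))) (abs_top hB (by norm_num) (by norm_num : 8 ≤ 10) (abs_step (abs_step (abs_step (abs_step (abs_step (abs_step (abs_step (abs_step (abs_step1 (abs_step1 (abs_base (by norm_num : (0:ℝ) ≤ 32)) hr1) hr1) hLα) hLα) hLα) hw₀) hw₁) hw₁) hη₀) hη₁))) (abs_top hB (by norm_num) (by norm_num : 7 ≤ 10) (abs_step (abs_step (abs_step (abs_step (abs_step (abs_step (abs_step (abs_step1 (abs_step1 (abs_base (by norm_num : (0:ℝ) ≤ 24)) hr1) hr1) hLα) hLα) hLα) hβ) hw₁) hw₁) hη₁))) (abs_top hB (by norm_num) (by norm_num : 8 ≤ 10) (abs_step (abs_step (abs_step (abs_step (abs_step (abs_step (abs_step (abs_step (abs_step1 (abs_step1 (abs_base (by norm_num : (0:ℝ) ≤ 16)) hr1) hr1) hLα) hLα) hLα) hβ) hγ) hw₁) hw₁) hη₁))) (abs_top hB (by norm_num) (by norm_num : 8 ≤ 10) (abs_step (abs_step (abs_step (abs_step (abs_step (abs_step (abs_step (abs_step (abs_step1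 (abs_step1 (abs_step1 (abs_base (by norm_num : (0:ℝ) ≤ 48)) hr1) hr1) hr1) hLα) hLα) hLα) hw₀) hw₁) hw₁) hη₁) hη₁))) (abs_top hB (by norm_num) (by norm_num : 9 ≤ 10) (abs_step (abs_step (abs_step (abs_step (abs_step (abs_step (abs_step (abs_step (abs_step (abs_step1 (abs_base (by norm_num : (0:ℝ) ≤ 48)) hr1) hLα) hLα) hLα) hLα) hw₁) hw₁) hw₁) hη₀) hη₀))) (abs_top hB (by norm_num) (by norm_num : 9 ≤ 10) (abs_step (abs_step (abs_step (abs_step (abs_step (abs_step (abs_step (abs_step (abs_step (abs_step1 (abs_step1 (abs_base (by norm_num : (0:ℝ) ≤ 32)) hr1) hr1) hLα) hLα) hLα) hLα) hw₁) hw₁) hw₁) hη₀) hη₁))) (abs_top hB (by norm_num) (by norm_num : 9 ≤ 10) (abs_step (abs_step (abs_step (abs_step (abs_step (abs_step (abs_step (abs_step (abs_step (abs_step1 (abs_step1 (abs_step1 (abs_base (by norm_num : (0:ℝ) ≤ 80)) hr1) hr1) hr1) hLα) hLα) hLα) hLα) hw₁) hw₁) hw₁) hη₁) hη₁))) ?_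
    norm_num
  have hx5 : |g ^ 3 * μ| ≤ |g| ^ 3 + |μ| ^ 3 := by
    simpa using abs_pow_mul_pow_le_cube hg hμ (i := 3) (k := 1) (by norm_num)
  have ht5 : |((128 : ℝ) * r * Lα * w₀ * w₀ * w₀ * η₀ * η₀ + (32 : ℝ) * r * Lα * β * w₀ * w₀ * η₀ - (16 : ℝ) * r * Lα * Lα * ξ * w₀ * w₁ - (16 : ℝ) * r * Lα * Lα * β * w₀ * w₁ * η₀ + (4 : ℝ) * r * Lα * Lα * β * β * γh * w₁ - (128 : ℝ) * r * r * Lα * Lα * w₀ * w₀ * w₁ * η₀ * η₁ - (16 : ℝ) * r * r * Lα * Lα * β * w₀ * w₁ * η₁ - (80 : ℝ) * r * Lα * Lα * Lα * w₀ * w₁ * w₁ * η₀ * η₀ + (16 : ℝ) * r * Lα * Lα * Lα * ξ * w₁ * w₁ + (8 : ℝ) * r * Lα * Lα * Lα * β * w₁ * w₁ * η₀ + (16 : ℝ) * r * Lα * Lα * Lα * β * γh * w₁ * w₁ * η₀ + (32 : ℝ) * r * r * Lα * Lα * Lα * w₀ * w₁ * w₁ * η₀ * η₁ + (24 : ℝ)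 * r * r * Lα * Lα * Lα * β * w₁ * w₁ * η₁ - (16 : ℝ) * r * r * Lα * Lα * Lα * β * γh * w₁ * w₁ * η₁ + (48 : ℝ) * r * r * r * Lα * Lα * Lα * w₀ * w₁ * w₁ * η₁ * η₁ + (48 : ℝ) * r * Lα * Lα * Lα * Lα * w₁ * w₁ * w₁ * η₀ * η₀ + (32 : ℝ) * r * r * Lα * Lα * Lα * Lα * w₁ * w₁ * w₁ * η₀ * η₁ - (80 : ℝ) * r * r * r * Lα * Lα * Lα * Lα * w₁ * w₁ * w₁ * η₁ * η₁) * (g ^ 3 * μ)| ≤ (740 : ℝ) * B ^ 10 * (|g| ^ 3 + |μ| ^ 3) := abs_coef_mul hc5 hx5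
  have hc6 : |(64 : ℝ) * r * Lα * w₀ * w₀ * w₀ * η₀ * η₀ * η₀ + (16 : ℝ) * r * Lα * β * w₀ * w₀ * η₀ * η₀ + (4 : ℝ) * r * Lα * Lα * β * ξ * w₁ - (64 : ℝ) * r * r * Lα * Lα * w₀ * w₀ * w₁ * η₀ * η₀ * η₁ + (4 : ℝ) * r * r * Lα * Lα * β * β * w₁ * η₁ + (16 : ℝ) * r * Lα * Lα * Lα * ξ * w₁ * w₁ * η₀ + (4 : ℝ) * r * Lα * Lα * Lα * β * w₁ * w₁ * η₀ * η₀ - (16 : ℝ) * r * r * Lα * Lα * Lα * ξ * w₁ * w₁ * η₁ + (24 : ℝ) * r * r * Lα * Lα * Lα * β * w₁ * w₁ * η₀ * η₁ - (28 : ℝ) * r * r * r * Lα * Lα * Lα * β * w₁ * w₁ * η₁ * η₁ + (16 : ℝ) * r * Lα * Lα * Lα * Lα * w₁ * w₁ * w₁ * η₀ * η₀ * η₀ + (16 : ℝ) * r * r * Lα * Lα * Lα * Lα * w₁ * w₁ * w₁ * η₀ * η₀ * η₁ - (80 : ℝ) * r * r * r * Lα * Lα * Lα * Lα * w₁ * w₁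 * w₁ * η₀ * η₁ * η₁ + (48 : ℝ) * r * r * r * r * Lα * Lα * Lα * Lα * w₁ * w₁ * w₁ * η₁ * η₁ * η₁| ≤ (400 : ℝ) * B ^ 10 := by
    refine le_of_le_of_eq (abs_add_le_of (abs_sub_le_of (abs_add_le_of (abs_add_le_of (abs_sub_le_of (abs_add_le_of (abs_sub_le_of (abs_add_le_of (abs_add_le_of (abs_add_le_of (abs_sub_le_of (abs_add_le_of (abs_add_le_of (abs_top hB (by norm_num) (by norm_num : 7 ≤ 10) (abs_step (abs_step (abs_step (abs_step (abs_step (abs_step (abs_step (abs_step1 (abs_base (by norm_num : (0:ℝ) ≤ 64)) hr1) hLα) hw₀) hw₀) hw₀) hη₀) hη₀) hη₀)) (abs_top hB (by norm_num) (by norm_num : 6 ≤ 10) (abs_step (abs_step (abs_step (abs_step (abs_step (abs_step (abs_step1 (abs_base (by norm_num : (0:ℝ) ≤ 16)) hr1) hLα) hβ) hw₀) hw₀) hη₀) hη₀))) (abs_top hB (by norm_num) (by norm_num : 5 ≤ 10) (abs_step (abs_step (abs_step (abs_step (abs_step (abs_step1 (abs_base (by norm_num : (0:ℝ) ≤ 4))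 hr1) hLα) hLα) hβ) hξ) hw₁))) (abs_top hB (by norm_num) (by norm_num : 8 ≤ 10) (abs_step (abs_step (abs_step (abs_step (abs_step (abs_step (abs_step (abs_step (abs_step1 (abs_step1 (abs_base (by norm_num : (0:ℝ) ≤ 64)) hr1) hr1) hLα) hLα) hw₀) hw₀) hw₁) hη₀) hη₀) hη₁))) (abs_top hB (by norm_num) (by norm_num : 6 ≤ 10) (abs_step (abs_step (abs_step (abs_step (abs_step (abs_step (abs_step1 (abs_step1 (abs_base (by norm_num : (0:ℝ) ≤ 4)) hr1) hr1) hLα) hLα) hβ) hβ) hw₁) hη₁))) (abs_top hB (by norm_num) (by norm_num : 7 ≤ 10) (abs_step (abs_step (abs_step (abs_step (abs_step (abs_step (abs_step (abs_step1 (abs_base (by norm_num : (0:ℝ) ≤ 16)) hr1) hLα) hLα) hLα) hξ) hw₁) hw₁) hη₀))) (abs_top hB (by norm_num) (by norm_num : 8 ≤ 10) (abs_step (abs_step (abs_step (abs_step (abs_step (abs_step (abs_step (abs_step (abs_step1 (abs_base (by norm_num : (0:ℝ) ≤ 4)) hr1) hLα) hLα) hLα) hβ) hw₁) hw₁) hη₀)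 hη₀))) (abs_top hB (by norm_num) (by norm_num : 7 ≤ 10) (abs_step (abs_step (abs_step (abs_step (abs_step (abs_step (abs_step (abs_step1 (abs_step1 (abs_base (by norm_num : (0:ℝ) ≤ 16)) hr1) hr1) hLα) hLα) hLα) hξ) hw₁) hw₁) hη₁))) (abs_top hB (by norm_num) (by norm_num : 8 ≤ 10) (abs_step (abs_step (abs_step (abs_step (abs_step (abs_step (abs_step (abs_step (abs_step1 (abs_step1 (abs_base (by norm_num : (0:ℝ) ≤ 24)) hr1) hr1) hLα) hLα) hLα) hβ) hw₁) hw₁) hη₀) hη₁))) (abs_top hB (by norm_num) (by norm_num : 8 ≤ 10) (abs_step (abs_step (abs_step (abs_step (abs_step (abs_step (abs_step (abs_step (abs_step1 (abs_step1 (abs_step1 (abs_base (by norm_num : (0:ℝ) ≤ 28)) hr1) hr1) hr1) hLα) hLα) hLα) hβ) hw₁) hw₁) hη₁) hη₁))) (abs_top hB (by norm_num) (by norm_num : 10 ≤ 10) (abs_step (abs_step (abs_step (abs_step (abs_step (abs_step (abs_step (abs_step (abs_step (abs_step (abs_step1 (abs_base (by norm_num : (0:ℝ) ≤ 16)) hr1)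 hLα) hLα) hLα) hLα) hw₁) hw₁) hw₁) hη₀) hη₀) hη₀))) (abs_top hB (by norm_num) (by norm_num : 10 ≤ 10) (abs_step (abs_step (abs_step (abs_step (abs_step (abs_step (abs_step (abs_step (abs_step (abs_step (abs_step1 (abs_step1 (abs_base (by norm_num : (0:ℝ) ≤ 16)) hr1) hr1) hLα) hLα) hLα) hLα) hw₁) hw₁) hw₁) hη₀) hη₀) hη₁))) (abs_top hB (by norm_num) (by norm_num : 10 ≤ 10) (abs_step (abs_step (abs_step (abs_step (abs_step (abs_step (abs_step (abs_step (abs_step (abs_step (abs_step1 (abs_step1 (abs_step1 (abs_base (by norm_num : (0:ℝ) ≤ 80)) hr1) hr1) hr1) hLα) hLα) hLα) hLα) hw₁) hw₁) hw₁) hη₀) hη₁) hη₁))) (abs_top hB (by norm_num) (by norm_num : 10 ≤ 10) (abs_step (abs_step (abs_step (abs_step (abs_step (abs_step (abs_step (abs_step (abs_step (abs_step (abs_step1 (abs_step1 (abs_step1 (abs_step1 (abs_base (by norm_num : (0:ℝ) ≤ 48)) hr1) hr1) hr1) hr1) hLα) hLα) hLα) hLα) hw₁) hw₁) hw₁) hη₁)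 hη₁) hη₁))) ?_
    norm_num
  have hx6 : |g ^ 4| ≤ |g| ^ 3 + |μ| ^ 3 := by
    simpa using abs_pow_mul_pow_le_cube hg hμ (i := 4) (k := 0) (by norm_num)
  have ht6 : |((64 : ℝ) * r * Lα * w₀ * w₀ * w₀ * η₀ * η₀ * η₀ + (16 : ℝ) * r * Lα * β * w₀ * w₀ * η₀ * η₀ + (4 : ℝ) * r * Lα * Lα * β * ξ * w₁ - (64 : ℝ) * r * r * Lα * Lα * w₀ * w₀ * w₁ * η₀ * η₀ * η₁ + (4 : ℝ) * r * r * Lα * Lα * β * β * w₁ * η₁ + (16 : ℝ) * r * Lα * Lα * Lα * ξ * w₁ * w₁ * η₀ + (4 : ℝ) * r * Lα * Lα * Lα * β * w₁ * w₁ * η₀ * η₀ - (16 : ℝ) * r * r * Lα * Lα * Lα * ξ * w₁ * w₁ * η₁ + (24 : ℝ) * r * r * Lα * Lα * Lα * β * w₁ * w₁ * η₀ * η₁ - (28 : ℝ) * r * r * r * Lα * Lα * Lα * β * w₁ * w₁ * η₁ * η₁ + (16 : ℝ) * r * Lα * Lα * Lα * Lα * w₁ * w₁ * w₁ * η₀ *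 η₀ * η₀ + (16 : ℝ) * r * r * Lα * Lα * Lα * Lα * w₁ * w₁ * w₁ * η₀ * η₀ * η₁ - (80 : ℝ) * r * r * r * Lα * Lα * Lα * Lα * w₁ * w₁ * w₁ * η₀ * η₁ * η₁ + (48 : ℝ) * r * r * r * r * Lα * Lα * Lα * Lα * w₁ * w₁ * w₁ * η₁ * η₁ * η₁) * (g ^ 4)| ≤ (400 : ℝ) * B ^ 10 * (|g| ^ 3 + |μ| ^ 3) := abs_coef_mul hc6 hx6
  refine le_of_le_of_eq (abs_add_le_of (abs_add_le_of (abs_add_le_of (abs_add_le_of (abs_add_le_of (abs_add_le_of (ht0) ht1) ht2) ht3) ht4) ht5) ht6) ?_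
  ring

/-- **Proposition 5.3.1 (Slade), `μ`-component, with explicit constants.** Under the hypotheses of
`Slade2017_prop531_fst`, for `|ĝ|, |μ̂| ≤ 1`,
`|(T_{j+1}Φ^{(0)}_{pt,j}(ĝ,μ̂))_μ - Φ̄_j(T_j(ĝ,μ̂))_μ| ≤ 1667·B^{11}(|ĝ|³ + |μ̂|³)`: the
`μ`-component of "`e_{pt,j}(s,μ) = O(|s|³ + |s|²ε + |μ|³)`" (here even without an `ε|s|²` term).
[cite: Slade2017, Proposition 5.3.1] -/
theorem Slade2017_prop531_snd {Lε Lα r β γh ξ w₀ w₁ η η₀ η₁ B : ℝ} (hr : Lε = r * Lα)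
    (hη : η = η₀ - r * η₁) (hB : 1 ≤ B) (hLα : |Lα| ≤ B) (hr1 : |r| ≤ 1) (hβ : |β| ≤ B)
    (hγ : |γh| ≤ B) (hξ : |ξ| ≤ B) (hw₀ : |w₀| ≤ B) (hw₁ : |w₁| ≤ B) (hη₀ : |η₀| ≤ B)
    (hη₁ : |η₁| ≤ B) {g μ : ℝ} (hg : |g| ≤ 1) (hμ : |μ| ≤ 1) :
    |cvM η₁ w₁ (ptFlowG Lε Lα β η w₀ w₁ g μ) (ptFlowM Lα β γh ξ η w₀ w₁ g μ)
      - barFlowM Lα γh β (xiW r β γh ξ η₀ η₁) (cvS η₀ w₀ g μ) (cvM η₀ w₀ g μ)|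
      ≤ 1667 * B ^ 11 * (|g| ^ 3 + |μ| ^ 3) := by
  rw [Slade2017_prop531_snd_eq hr hη]
  have hc0 : |(2 : ℝ) * Lα * Lα * w₀ * w₁ - (2 : ℝ) * Lα * Lα * Lα * w₁ * w₁| ≤ (4 : ℝ) * B ^ 11 := by
    refine le_of_le_of_eq (abs_sub_le_of (abs_top hB (by norm_num) (by norm_num : 4 ≤ 11) (abs_step (abs_step (abs_step (abs_step (abs_base (by norm_num : (0:ℝ) ≤ 2)) hLα) hLα) hw₀) hw₁)) (abs_top hB (by norm_num) (by norm_num : 5 ≤ 11) (abs_step (abs_step (abs_step (abs_step (abs_step (abs_base (by norm_num : (0:ℝ) ≤ 2)) hLα) hLα) hLα) hw₁) hw₁))) ?_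
    norm_num
  have hx0 : |μ ^ 3| ≤ |g| ^ 3 + |μ| ^ 3 := by
    rw [abs_pow]; linarith [pow_nonneg (abs_nonneg g) 3]
  have ht0 : |((2 : ℝ) * Lα * Lα * w₀ * w₁ - (2 : ℝ) * Lα * Lα * Lα * w₁ * w₁) * (μ ^ 3)| ≤ (4 : ℝ) * B ^ 11 * (|g| ^ 3 + |μ| ^ 3) := abs_coef_mul hc0 hx0
  have hc1 : |(1 : ℝ) * Lα * Lα * w₀ * w₀ * w₁ - (2 : ℝ) * Lα * Lα * Lα * w₀ * w₁ * w₁ + (1 : ℝ) * Lα * Lα * Lα * Lα * w₁ * w₁ * w₁| ≤ (4 : ℝ) * B ^ 11 := by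
    refine le_of_le_of_eq (abs_add_le_of (abs_sub_le_of (abs_top hB (by norm_num) (by norm_num : 5 ≤ 11) (abs_step (abs_step (abs_step (abs_step (abs_step (abs_base (by norm_num : (0:ℝ) ≤ 1)) hLα) hLα) hw₀) hw₀) hw₁)) (abs_top hB (by norm_num) (by norm_num : 6 ≤ 11) (abs_step (abs_step (abs_step (abs_step (abs_step (abs_step (abs_base (by norm_num : (0:ℝ) ≤ 2)) hLα) hLα) hLα) hw₀) hw₁) hw₁))) (abs_top hB (by norm_num) (by norm_num : 7 ≤ 11) (abs_step (abs_step (abs_step (abs_step (abs_step (abs_step (abs_step (abs_base (by norm_num : (0:ℝ) ≤ 1)) hLα) hLα) hLα) hLα) hw₁) hw₁) hw₁))) ?_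
    norm_num
  have hx1 : |μ ^ 4| ≤ |g| ^ 3 + |μ| ^ 3 := by
    simpa using abs_pow_mul_pow_le_cube hg hμ (i := 0) (k := 4) (by norm_num)
  have ht1 : |((1 : ℝ) * Lα * Lα * w₀ * w₀ * w₁ - (2 : ℝ) * Lα * Lα * Lα * w₀ * w₁ * w₁ + (1 : ℝ) * Lα * Lα * Lα * Lα * w₁ * w₁ * w₁) * (μ ^ 4)| ≤ (4 : ℝ) * B ^ 11 * (|g| ^ 3 + |μ| ^ 3) := abs_coef_mul hc1 hx1
  have hc2 : |(5 : ℝ) * Lα * β * γh * w₀ + (10 : ℝ) * Lα * Lα * w₀ * w₁ * η₀ - (2 : ℝ) * Lα * Lα * β * γh * w₁ + (10 : ℝ) * r * Lα * Lα * w₀ * w₁ * η₁ - (6 : ℝ) * Lα * Lα * Lα * w₁ * w₁ * η₀ - (14 : ℝ) * r * Lα * Lα * Lα * w₁ * w₁ * η₁| ≤ (47 : ℝ) * B ^ 11 := by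
    refine le_of_le_of_eq (abs_sub_le_of (abs_sub_le_of (abs_add_le_of (abs_sub_le_of (abs_add_le_of (abs_top hB (by norm_num) (by norm_num : 4 ≤ 11) (abs_step (abs_step (abs_step (abs_step (abs_base (by norm_num : (0:ℝ) ≤ 5)) hLα) hβ) hγ) hw₀)) (abs_top hB (by norm_num) (by norm_num : 5 ≤ 11) (abs_step (abs_step (abs_step (abs_step (abs_step (abs_base (by norm_num : (0:ℝ) ≤ 10)) hLα) hLα) hw₀) hw₁) hη₀))) (abs_top hB (by norm_num) (by norm_num : 5 ≤ 11) (abs_step (abs_step (abs_step (abs_step (abs_step (abs_base (by norm_num : (0:ℝ) ≤ 2)) hLα) hLα) hβ) hγ) hw₁))) (abs_top hB (by norm_num) (by norm_num : 5 ≤ 11) (abs_step (abs_step (abs_step (abs_step (abs_step (abs_step1 (abs_base (by norm_num : (0:ℝ) ≤ 10)) hr1) hLα) hLα) hw₀) hw₁) hη₁))) (abs_top hB (by norm_num) (by norm_num : 6 ≤ 11) (abs_step (abs_step (abs_step (abs_step (abs_step (abs_step (abs_base (by norm_num : (0:ℝ) ≤ 6)) hLα) hLα) hLα) hw₁) hw₁)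 hη₀))) (abs_top hB (by norm_num) (by norm_num : 6 ≤ 11) (abs_step (abs_step (abs_step (abs_step (abs_step (abs_step (abs_step1 (abs_base (by norm_num : (0:ℝ) ≤ 14)) hr1) hLα) hLα) hLα) hw₁) hw₁) hη₁))) ?_
    norm_num
  have hx2 : |g * μ ^ 2| ≤ |g| ^ 3 + |μ| ^ 3 := by
    simpa using abs_pow_mul_pow_le_cube hg hμ (i := 1) (k := 2) (by norm_num)
  have ht2 : |((5 : ℝ) * Lα * β * γh * w₀ + (10 : ℝ) * Lα * Lα * w₀ * w₁ * η₀ - (2 : ℝ) * Lα * Lα * β * γh * w₁ + (10 : ℝ) * r * Lα * Lα * w₀ * w₁ * η₁ - (6 : ℝ) * Lα * Lα * Lα * w₁ * w₁ * η₀ - (14 : ℝ) * r * Lα * Lα * Lα * w₁ * w₁ * η₁) * (g * μ ^ 2)| ≤ (47 : ℝ) * B ^ 11 * (|g| ^ 3 + |μ| ^ 3) := abs_coef_mul hc2 hx2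
  have hc3 : |(4 : ℝ) * Lα * β * γh * w₀ * w₀ + (8 : ℝ) * Lα * Lα * w₀ * w₀ * w₁ * η₀ - (2 : ℝ) * Lα * Lα * β * γh * w₀ * w₁ + (8 : ℝ) * r * Lα * Lα * w₀ * w₀ * w₁ * η₁ - (12 : ℝ) * Lα * Lα * Lα * w₀ * w₁ * w₁ * η₀ + (2 : ℝ) * Lα * Lα * Lα * β * γh * w₁ * w₁ - (20 : ℝ) * r * Lα * Lα * Lα * w₀ * w₁ * w₁ * η₁ + (4 : ℝ) * Lα * Lα * Lα * Lα * w₁ * w₁ * w₁ * η₀ + (12 : ℝ) * r * Lα * Lα * Lα * Lα * w₁ * w₁ * w₁ * η₁| ≤ (72 : ℝ) * B ^ 11 := by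
    refine le_of_le_of_eq (abs_add_le_of (abs_add_le_of (abs_sub_le_of (abs_add_le_of (abs_sub_le_of (abs_add_le_of (abs_sub_le_of (abs_add_le_of (abs_top hB (by norm_num) (by norm_num : 5 ≤ 11) (abs_step (abs_step (abs_step (abs_step (abs_step (abs_base (by norm_num : (0:ℝ) ≤ 4)) hLα) hβ) hγ) hw₀) hw₀)) (abs_top hB (by norm_num) (by norm_num : 6 ≤ 11) (abs_step (abs_step (abs_step (abs_step (abs_step (abs_step (abs_base (by norm_num : (0:ℝ) ≤ 8)) hLα) hLα) hw₀) hw₀) hw₁) hη₀))) (abs_top hB (by norm_num) (by norm_num : 6 ≤ 11) (abs_step (abs_step (abs_step (abs_step (abs_step (abs_step (abs_base (by norm_num : (0:ℝ) ≤ 2)) hLα) hLα) hβ) hγ) hw₀) hw₁))) (abs_top hB (by norm_num) (by norm_num : 6 ≤ 11) (abs_step (abs_step (abs_step (abs_step (abs_step (abs_step (abs_step1 (abs_base (by norm_num : (0:ℝ) ≤ 8)) hr1) hLα) hLα) hw₀) hw₀) hw₁) hη₁))) (abs_top hB (by norm_num) (by norm_num : 7 ≤ 11) (abs_step (abs_step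 (abs_step (abs_step (abs_step (abs_step (abs_step (abs_base (by norm_num : (0:ℝ) ≤ 12)) hLα) hLα) hLα) hw₀) hw₁) hw₁) hη₀))) (abs_top hB (by norm_num) (by norm_num : 7 ≤ 11) (abs_step (abs_step (abs_step (abs_step (abs_step (abs_step (abs_step (abs_base (by norm_num : (0:ℝ) ≤ 2)) hLα) hLα) hLα) hβ) hγ) hw₁) hw₁))) (abs_top hB (by norm_num) (by norm_num : 7 ≤ 11) (abs_step (abs_step (abs_step (abs_step (abs_step (abs_step (abs_step (abs_step1 (abs_base (by norm_num : (0:ℝ) ≤ 20)) hr1) hLα) hLα) hLα) hw₀) hw₁) hw₁) hη₁))) (abs_top hB (by norm_num) (by norm_num : 8 ≤ 11) (abs_step (abs_step (abs_step (abs_step (abs_step (abs_step (abs_step (abs_step (abs_base (by norm_num : (0:ℝ) ≤ 4)) hLα) hLα) hLα) hLα) hw₁) hw₁) hw₁) hη₀))) (abs_top hB (by norm_num) (by norm_num : 8 ≤ 11) (abs_step (abs_step (abs_step (abs_step (abs_step (abs_step (abs_step (abs_step (abs_step1 (abs_base (by norm_num : (0:ℝ) ≤ 12)) hr1) hLα)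 hLα) hLα) hLα) hw₁) hw₁) hw₁) hη₁))) ?_
    norm_num
  have hx3 : |g * μ ^ 3| ≤ |g| ^ 3 + |μ| ^ 3 := by
    simpa using abs_pow_mul_pow_le_cube hg hμ (i := 1) (k := 3) (by norm_num)
  have ht3 : |((4 : ℝ) * Lα * β * γh * w₀ * w₀ + (8 : ℝ) * Lα * Lα * w₀ * w₀ * w₁ * η₀ - (2 : ℝ) * Lα * Lα * β * γh * w₀ * w₁ + (8 : ℝ) * r * Lα * Lα * w₀ * w₀ * w₁ * η₁ - (12 : ℝ) * Lα * Lα * Lα * w₀ * w₁ * w₁ * η₀ + (2 : ℝ) * Lα * Lα * Lα * β * γh * w₁ * w₁ - (20 : ℝ) * r * Lα * Lα * Lα * w₀ * w₁ * w₁ * η₁ + (4 : ℝ) * Lα * Lα * Lα * Lα * w₁ * w₁ * w₁ * η₀ + (12 : ℝ) * r * Lα * Lα * Lα * Lα * w₁ * w₁ * w₁ * η₁) * (g * μ ^ 3)| ≤ (72 : ℝ) * B ^ 11 * (|g| ^ 3 + |μ| ^ 3) := abs_coef_mul hc3 hx3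
  have hc4 : |(8 : ℝ) * Lα * ξ * w₀ + (4 : ℝ) * Lα * β * γh * w₀ * η₀ + (8 : ℝ) * r * Lα * β * w₀ * η₁ + (8 : ℝ) * Lα * Lα * w₀ * w₁ * η₀ * η₀ - (2 : ℝ) * Lα * Lα * ξ * w₁ - (2 : ℝ) * Lα * Lα * β * γh * w₁ * η₀ + (16 : ℝ) * r * Lα * Lα * w₀ * w₁ * η₀ * η₁ - (4 : ℝ) * r * Lα * Lα * β * w₁ * η₁ - (2 : ℝ) * r * Lα * Lα * β * γh * w₁ * η₁ - (24 : ℝ) * r * r * Lα * Lα * w₀ * w₁ * η₁ * η₁ - (6 : ℝ) * Lα * Lα * Lα * w₁ * w₁ * η₀ * η₀ - (28 : ℝ) * r * Lα * Lα * Lα * w₁ * w₁ * η₀ * η₁ + (34 : ℝ) * r * r * Lα * Lα * Lα * w₁ * w₁ * η₁ * η₁| ≤ (146 : ℝ) * B ^ 11 := by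
    refine le_of_le_of_eq (abs_add_le_of (abs_sub_le_of (abs_sub_le_of (abs_sub_le_of (abs_sub_le_of (abs_sub_le_of (abs_add_le_of (abs_sub_le_of (abs_sub_le_of (abs_add_le_of (abs_add_le_of (abs_add_le_of (abs_top hB (by norm_num) (by norm_num : 3 ≤ 11) (abs_step (abs_step (abs_step (abs_base (by norm_num : (0:ℝ) ≤ 8)) hLα) hξ) hw₀)) (abs_top hB (by norm_num) (by norm_num : 5 ≤ 11) (abs_step (abs_step (abs_step (abs_step (abs_step (abs_base (by norm_num : (0:ℝ) ≤ 4)) hLα) hβ) hγ) hw₀) hη₀))) (abs_top hB (by norm_num) (by norm_num : 4 ≤ 11) (abs_step (abs_step (abs_step (abs_step (abs_step1 (abs_base (by norm_num : (0:ℝ) ≤ 8)) hr1) hLα) hβ) hw₀) hη₁))) (abs_top hB (by norm_num) (by norm_num : 6 ≤ 11) (abs_step (abs_step (abs_step (abs_step (abs_step (abs_step (abs_base (by norm_num : (0:ℝ) ≤ 8)) hLα) hLα) hw₀) hw₁) hη₀) hη₀))) (abs_top hB (by norm_num) (by norm_num : 4 ≤ 11) (abs_step (abs_step (abs_step (abs_step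 (abs_base (by norm_num : (0:ℝ) ≤ 2)) hLα) hLα) hξ) hw₁))) (abs_top hB (by norm_num) (by norm_num : 6 ≤ 11) (abs_step (abs_step (abs_step (abs_step (abs_step (abs_step (abs_base (by norm_num : (0:ℝ) ≤ 2)) hLα) hLα) hβ) hγ) hw₁) hη₀))) (abs_top hB (by norm_num) (by norm_num : 6 ≤ 11) (abs_step (abs_step (abs_step (abs_step (abs_step (abs_step (abs_step1 (abs_base (by norm_num : (0:ℝ) ≤ 16)) hr1) hLα) hLα) hw₀) hw₁) hη₀) hη₁))) (abs_top hB (by norm_num) (by norm_num : 5 ≤ 11) (abs_step (abs_step (abs_step (abs_step (abs_step (abs_step1 (abs_base (by norm_num : (0:ℝ) ≤ 4)) hr1) hLα) hLα) hβ) hw₁) hη₁))) (abs_top hB (by norm_num) (by norm_num : 6 ≤ 11) (abs_step (abs_step (abs_step (abs_step (abs_step (abs_step (abs_step1 (abs_base (by norm_num : (0:ℝ) ≤ 2)) hr1) hLα) hLα) hβ) hγ) hw₁) hη₁))) (abs_top hB (by norm_num) (by norm_num : 6 ≤ 11) (abs_step (abs_step (abs_step (abs_step (abs_step (abs_step (abs_step1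 (abs_step1 (abs_base (by norm_num : (0:ℝ) ≤ 24)) hr1) hr1) hLα) hLα) hw₀) hw₁) hη₁) hη₁))) (abs_top hB (by norm_num) (by norm_num : 7 ≤ 11) (abs_step (abs_step (abs_step (abs_step (abs_step (abs_step (abs_step (abs_base (by norm_num : (0:ℝ) ≤ 6)) hLα) hLα) hLα) hw₁) hw₁) hη₀) hη₀))) (abs_top hB (by norm_num) (by norm_num : 7 ≤ 11) (abs_step (abs_step (abs_step (abs_step (abs_step (abs_step (abs_step (abs_step1 (abs_base (by norm_num : (0:ℝ) ≤ 28)) hr1) hLα) hLα) hLα) hw₁) hw₁) hη₀) hη₁))) (abs_top hB (by norm_num) (by norm_num : 7 ≤ 11) (abs_step (abs_step (abs_step (abs_step (abs_step (abs_step (abs_step (abs_step1 (abs_step1 (abs_base (by norm_num : (0:ℝ) ≤ 34)) hr1) hr1) hLα) hLα) hLα) hw₁) hw₁) hη₁) hη₁))) ?_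
    norm_num
  have hx4 : |g ^ 2 * μ| ≤ |g| ^ 3 + |μ| ^ 3 := by
    simpa using abs_pow_mul_pow_le_cube hg hμ (i := 2) (k := 1) (by norm_num)
  have ht4 : |((8 : ℝ) * Lα * ξ * w₀ + (4 : ℝ) * Lα * β * γh * w₀ * η₀ + (8 : ℝ) * r * Lα * β * w₀ * η₁ + (8 : ℝ) * Lα * Lα * w₀ * w₁ * η₀ * η₀ - (2 : ℝ) * Lα * Lα * ξ * w₁ - (2 : ℝ) * Lα * Lα * β * γh * w₁ * η₀ + (16 : ℝ) * r * Lα * Lα * w₀ * w₁ * η₀ * η₁ - (4 : ℝ) * r * Lα * Lα * β * w₁ * η₁ - (2 : ℝ) * r * Lα * Lα * β * γh * w₁ * η₁ - (24 : ℝ) * r * r * Lα * Lα * w₀ * w₁ * η₁ * η₁ - (6 : ℝ) * Lα * Lα * Lα * w₁ * w₁ * η₀ * η₀ - (28 : ℝ) * r * Lα * Lα * Lα * w₁ * w₁ * η₀ * η₁ + (34 : ℝ) * r * r * Lα * Lα * Lα * w₁ * w₁ * η₁ * η₁) * (g ^ 2 * μ)| ≤ (146 : ℝ) * B ^ 11 *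 (|g| ^ 3 + |μ| ^ 3) := abs_coef_mul hc4 hx4
  have hc5 : |(16 : ℝ) * Lα * ξ * w₀ * w₀ + (4 : ℝ) * Lα * β * γh * w₀ * w₀ * η₀ + (16 : ℝ) * r * Lα * β * w₀ * w₀ * η₁ + (16 : ℝ) * Lα * Lα * w₀ * w₀ * w₁ * η₀ * η₀ - (2 : ℝ) * Lα * Lα * ξ * w₀ * w₁ - (8 : ℝ) * Lα * Lα * β * γh * w₀ * w₁ * η₀ + (1 : ℝ) * Lα * Lα * β * β * γh * γh * w₁ + (32 : ℝ) * r * Lα * Lα * w₀ * w₀ * w₁ * η₀ * η₁ - (4 : ℝ) * r * Lα * Lα * β * w₀ * w₁ * η₁ - (8 : ℝ) * r * Lα * Lα * β * γh * w₀ * w₁ * η₁ - (48 : ℝ) * r * r * Lα * Lα * w₀ * w₀ * w₁ * η₁ * η₁ - (18 : ℝ) * Lα * Lα * Lα * w₀ * w₁ * w₁ * η₀ * η₀ + (2 : ℝ) * Lα * Lα * Lα * ξ * w₁ * w₁ + (4 : ℝ) * Lα * Lα * Lα * β * γh * w₁ * w₁ * η₀ - (76 : ℝ) * r * Lα * Lα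 * Lα * w₀ * w₁ * w₁ * η₀ * η₁ + (4 : ℝ) * r * Lα * Lα * Lα * β * w₁ * w₁ * η₁ + (12 : ℝ) * r * Lα * Lα * Lα * β * γh * w₁ * w₁ * η₁ + (94 : ℝ) * r * r * Lα * Lα * Lα * w₀ * w₁ * w₁ * η₁ * η₁ + (6 : ℝ) * Lα * Lα * Lα * Lα * w₁ * w₁ * w₁ * η₀ * η₀ + (36 : ℝ) * r * Lα * Lα * Lα * Lα * w₁ * w₁ * w₁ * η₀ * η₁ - (42 : ℝ) * r * r * Lα * Lα * Lα * Lα * w₁ * w₁ * w₁ * η₁ * η₁| ≤ (449 : ℝ) * B ^ 11 := by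
    refine le_of_le_of_eq (abs_sub_le_of (abs_add_le_of (abs_add_le_of (abs_add_le_of (abs_add_le_of (abs_add_le_of (abs_sub_le_of (abs_add_le_of (abs_add_le_of (abs_sub_le_of (abs_sub_le_of (abs_sub_le_of (abs_sub_le_of (abs_add_le_of (abs_add_le_of (abs_sub_le_of (abs_sub_le_of (abs_add_le_of (abs_add_le_of (abs_add_le_of (abs_top hB (by norm_num) (by norm_num : 4 ≤ 11) (abs_step (abs_step (abs_step (abs_step (abs_base (by norm_num : (0:ℝ) ≤ 16)) hLα) hξ) hw₀) hw₀)) (abs_top hB (by norm_num) (by norm_num : 6 ≤ 11) (abs_step (abs_step (abs_step (abs_step (abs_step (abs_step (abs_base (by norm_num : (0:ℝ) ≤ 4)) hLα) hβ) hγ) hw₀) hw₀) hη₀))) (abs_top hB (by norm_num) (by norm_num : 5 ≤ 11) (abs_step (abs_step (abs_step (abs_step (abs_step (abs_step1 (abs_base (by norm_num : (0:ℝ) ≤ 16)) hr1) hLα) hβ) hw₀) hw₀) hη₁))) (abs_top hB (by norm_num) (by norm_num : 7 ≤ 11) (abs_step (abs_step (abs_step (abs_step (abs_step (abs_step (abs_step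 (abs_base (by norm_num : (0:ℝ) ≤ 16)) hLα) hLα) hw₀) hw₀) hw₁) hη₀) hη₀))) (abs_top hB (by norm_num) (by norm_num : 5 ≤ 11) (abs_step (abs_step (abs_step (abs_step (abs_step (abs_base (by norm_num : (0:ℝ) ≤ 2)) hLα) hLα) hξ) hw₀) hw₁))) (abs_top hB (by norm_num) (by norm_num : 7 ≤ 11) (abs_step (abs_step (abs_step (abs_step (abs_step (abs_step (abs_step (abs_base (by norm_num : (0:ℝ) ≤ 8)) hLα) hLα) hβ) hγ) hw₀) hw₁) hη₀))) (abs_top hB (by norm_num) (by norm_num : 7 ≤ 11) (abs_step (abs_step (abs_step (abs_step (abs_step (abs_step (abs_step (abs_base (by norm_num : (0:ℝ) ≤ 1)) hLα) hLα) hβ) hβ) hγ) hγ) hw₁))) (abs_top hB (by norm_num) (by norm_num : 7 ≤ 11) (abs_step (abs_step (abs_step (abs_step (abs_step (abs_step (abs_step (abs_step1 (abs_base (by norm_num : (0:ℝ) ≤ 32)) hr1) hLα) hLα) hw₀) hw₀) hw₁) hη₀) hη₁))) (abs_top hB (by norm_num) (by norm_num : 6 ≤ 11) (abs_step (abs_step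 (abs_step (abs_step (abs_step (abs_step (abs_step1 (abs_base (by norm_num : (0:ℝ) ≤ 4)) hr1) hLα) hLα) hβ) hw₀) hw₁) hη₁))) (abs_top hB (by norm_num) (by norm_num : 7 ≤ 11) (abs_step (abs_step (abs_step (abs_step (abs_step (abs_step (abs_step (abs_step1 (abs_base (by norm_num : (0:ℝ) ≤ 8)) hr1) hLα) hLα) hβ) hγ) hw₀) hw₁) hη₁))) (abs_top hB (by norm_num) (by norm_num : 7 ≤ 11) (abs_step (abs_step (abs_step (abs_step (abs_step (abs_step (abs_step (abs_step1 (abs_step1 (abs_base (by norm_num : (0:ℝ) ≤ 48)) hr1) hr1) hLα) hLα) hw₀) hw₀) hw₁) hη₁) hη₁))) (abs_top hB (by norm_num) (by norm_num : 8 ≤ 11) (abs_step (abs_step (abs_step (abs_step (abs_step (abs_step (abs_step (abs_step (abs_base (by norm_num : (0:ℝ) ≤ 18)) hLα) hLα) hLα) hw₀) hw₁) hw₁) hη₀) hη₀))) (abs_top hB (by norm_num) (by norm_num : 6 ≤ 11) (abs_step (abs_step (abs_step (abs_step (abs_step (abs_step (abs_base (by norm_num : (0:ℝ) ≤ 2))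 hLα) hLα) hLα) hξ) hw₁) hw₁))) (abs_top hB (by norm_num) (by norm_num : 8 ≤ 11) (abs_step (abs_step (abs_step (abs_step (abs_step (abs_step (abs_step (abs_step (abs_base (by norm_num : (0:ℝ) ≤ 4)) hLα) hLα) hLα) hβ) hγ) hw₁) hw₁) hη₀))) (abs_top hB (by norm_num) (by norm_num : 8 ≤ 11) (abs_step (abs_step (abs_step (abs_step (abs_step (abs_step (abs_step (abs_step (abs_step1 (abs_base (by norm_num : (0:ℝ) ≤ 76)) hr1) hLα) hLα) hLα) hw₀) hw₁) hw₁) hη₀) hη₁))) (abs_top hB (by norm_num) (by norm_num : 7 ≤ 11) (abs_step (abs_step (abs_step (abs_step (abs_step (abs_step (abs_step (abs_step1 (abs_base (by norm_num : (0:ℝ) ≤ 4)) hr1) hLα) hLα) hLα) hβ) hw₁) hw₁) hη₁))) (abs_top hB (by norm_num) (by norm_num : 8 ≤ 11) (abs_step (abs_step (abs_step (abs_step (abs_step (abs_step (abs_step (abs_step (abs_step1 (abs_base (by norm_num : (0:ℝ) ≤ 12)) hr1) hLα) hLα) hLα) hβ) hγ) hw₁) hw₁) hη₁))) (abs_top hB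 (by norm_num) (by norm_num : 8 ≤ 11) (abs_step (abs_step (abs_step (abs_step (abs_step (abs_step (abs_step (abs_step (abs_step1 (abs_step1 (abs_base (by norm_num : (0:ℝ) ≤ 94)) hr1) hr1) hLα) hLα) hLα) hw₀) hw₁) hw₁) hη₁) hη₁))) (abs_top hB (by norm_num) (by norm_num : 9 ≤ 11) (abs_step (abs_step (abs_step (abs_step (abs_step (abs_step (abs_step (abs_step (abs_step (abs_base (by norm_num : (0:ℝ) ≤ 6)) hLα) hLα) hLα) hLα) hw₁) hw₁) hw₁) hη₀) hη₀))) (abs_top hB (by norm_num) (by norm_num : 9 ≤ 11) (abs_step (abs_step (abs_step (abs_step (abs_step (abs_step (abs_step (abs_step (abs_step (abs_step1 (abs_base (by norm_num : (0:ℝ) ≤ 36)) hr1) hLα) hLα) hLα) hLα) hw₁) hw₁) hw₁) hη₀) hη₁))) (abs_top hB (by norm_num) (by norm_num : 9 ≤ 11) (abs_step (abs_step (abs_step (abs_step (abs_step (abs_step (abs_step (abs_step (abs_step (abs_step1 (abs_step1 (abs_base (by norm_num : (0:ℝ) ≤ 42)) hr1) hr1) hLα) hLα) hLα) hLα) hw₁)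 hw₁) hw₁) hη₁) hη₁))) ?_
    norm_num
  have hx5 : |g ^ 2 * μ ^ 2| ≤ |g| ^ 3 + |μ| ^ 3 := by
    simpa using abs_pow_mul_pow_le_cube hg hμ (i := 2) (k := 2) (by norm_num)
  have ht5 : |((16 : ℝ) * Lα * ξ * w₀ * w₀ + (4 : ℝ) * Lα * β * γh * w₀ * w₀ * η₀ + (16 : ℝ) * r * Lα * β * w₀ * w₀ * η₁ + (16 : ℝ) * Lα * Lα * w₀ * w₀ * w₁ * η₀ * η₀ - (2 : ℝ) * Lα * Lα * ξ * w₀ * w₁ - (8 : ℝ) * Lα * Lα * β * γh * w₀ * w₁ * η₀ + (1 : ℝ) * Lα * Lα * β * β * γh * γh * w₁ + (32 : ℝ) * r * Lα * Lα * w₀ * w₀ * w₁ * η₀ * η₁ - (4 : ℝ) * r * Lα * Lα * β * w₀ * w₁ * η₁ - (8 : ℝ) * r * Lα * Lα * β * γh * w₀ * w₁ * η₁ - (48 : ℝ) * r * r * Lα * Lα * w₀ * w₀ * w₁ * η₁ * η₁ - (18 : ℝ) * Lα * Lα * Lα * w₀ * w₁ * w₁ * η₀ * η₀ + (2 : ℝ)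 * Lα * Lα * Lα * ξ * w₁ * w₁ + (4 : ℝ) * Lα * Lα * Lα * β * γh * w₁ * w₁ * η₀ - (76 : ℝ) * r * Lα * Lα * Lα * w₀ * w₁ * w₁ * η₀ * η₁ + (4 : ℝ) * r * Lα * Lα * Lα * β * w₁ * w₁ * η₁ + (12 : ℝ) * r * Lα * Lα * Lα * β * γh * w₁ * w₁ * η₁ + (94 : ℝ) * r * r * Lα * Lα * Lα * w₀ * w₁ * w₁ * η₁ * η₁ + (6 : ℝ) * Lα * Lα * Lα * Lα * w₁ * w₁ * w₁ * η₀ * η₀ + (36 : ℝ) * r * Lα * Lα * Lα * Lα * w₁ * w₁ * w₁ * η₀ * η₁ - (42 : ℝ) * r * r * Lα * Lα * Lα * Lα * w₁ * w₁ * w₁ * η₁ * η₁) * (g ^ 2 * μ ^ 2)| ≤ (449 : ℝ) * B ^ 11 * (|g| ^ 3 + |μ| ^ 3) := abs_coef_mul hc5 hx5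
  have hc6 : |(8 : ℝ) * Lα * ξ * w₀ * η₀ - (4 : ℝ) * Lα * β * γh * w₀ * η₀ * η₀ + (8 : ℝ) * r * Lα * β * w₀ * η₀ * η₁ - (2 : ℝ) * Lα * Lα * ξ * w₁ * η₀ - (2 : ℝ) * r * Lα * Lα * ξ * w₁ * η₁ - (4 : ℝ) * r * Lα * Lα * β * w₁ * η₀ * η₁ + (4 : ℝ) * r * r * Lα * Lα * β * w₁ * η₁ * η₁ - (2 : ℝ) * Lα * Lα * Lα * w₁ * w₁ * η₀ * η₀ * η₀ - (14 : ℝ) * r * Lα * Lα * Lα * w₁ * w₁ * η₀ * η₀ * η₁ + (34 : ℝ) * r * r * Lα * Lα * Lα * w₁ * w₁ * η₀ * η₁ * η₁ - (18 : ℝ) * r * r * r * Lα * Lα * Lα * w₁ * w₁ * η₁ * η₁ * η₁| ≤ (100 : ℝ) * B ^ 11 := by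
    refine le_of_le_of_eq (abs_sub_le_of (abs_add_le_of (abs_sub_le_of (abs_sub_le_of (abs_add_le_of (abs_sub_le_of (abs_sub_le_of (abs_sub_le_of (abs_add_le_of (abs_sub_le_of (abs_top hB (by norm_num) (by norm_num : 4 ≤ 11) (abs_step (abs_step (abs_step (abs_step (abs_base (by norm_num : (0:ℝ) ≤ 8)) hLα) hξ) hw₀) hη₀)) (abs_top hB (by norm_num) (by norm_num : 6 ≤ 11) (abs_step (abs_step (abs_step (abs_step (abs_step (abs_step (abs_base (by norm_num : (0:ℝ) ≤ 4)) hLα) hβ) hγ) hw₀) hη₀) hη₀))) (abs_top hB (by norm_num) (by norm_num : 5 ≤ 11) (abs_step (abs_step (abs_step (abs_step (abs_step (abs_step1 (abs_base (by norm_num : (0:ℝ) ≤ 8)) hr1) hLα) hβ) hw₀) hη₀) hη₁))) (abs_top hB (by norm_num) (by norm_num : 5 ≤ 11) (abs_step (abs_step (abs_step (abs_step (abs_step (abs_base (by norm_num : (0:ℝ) ≤ 2)) hLα) hLα) hξ) hw₁) hη₀))) (abs_top hB (by norm_num) (by norm_num : 5 ≤ 11) (abs_step (abs_step (abs_step (abs_step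 (abs_step (abs_step1 (abs_base (by norm_num : (0:ℝ) ≤ 2)) hr1) hLα) hLα) hξ) hw₁) hη₁))) (abs_top hB (by norm_num) (by norm_num : 6 ≤ 11) (abs_step (abs_step (abs_step (abs_step (abs_step (abs_step (abs_step1 (abs_base (by norm_num : (0:ℝ) ≤ 4)) hr1) hLα) hLα) hβ) hw₁) hη₀) hη₁))) (abs_top hB (by norm_num) (by norm_num : 6 ≤ 11) (abs_step (abs_step (abs_step (abs_step (abs_step (abs_step (abs_step1 (abs_step1 (abs_base (by norm_num : (0:ℝ) ≤ 4)) hr1) hr1) hLα) hLα) hβ) hw₁) hη₁) hη₁))) (abs_top hB (by norm_num) (by norm_num : 8 ≤ 11) (abs_step (abs_step (abs_step (abs_step (abs_step (abs_step (abs_step (abs_step (abs_base (by norm_num : (0:ℝ) ≤ 2)) hLα) hLα) hLα) hw₁) hw₁) hη₀) hη₀) hη₀))) (abs_top hB (by norm_num) (by norm_num : 8 ≤ 11) (abs_step (abs_step (abs_step (abs_step (abs_step (abs_step (abs_step (abs_step (abs_step1 (abs_base (by norm_num : (0:ℝ) ≤ 14)) hr1) hLα) hLα) hLα) hw₁) hw₁)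 hη₀) hη₀) hη₁))) (abs_top hB (by norm_num) (by norm_num : 8 ≤ 11) (abs_step (abs_step (abs_step (abs_step (abs_step (abs_step (abs_step (abs_step (abs_step1 (abs_step1 (abs_base (by norm_num : (0:ℝ) ≤ 34)) hr1) hr1) hLα) hLα) hLα) hw₁) hw₁) hη₀) hη₁) hη₁))) (abs_top hB (by norm_num) (by norm_num : 8 ≤ 11) (abs_step (abs_step (abs_step (abs_step (abs_step (abs_step (abs_step (abs_step (abs_step1 (abs_step1 (abs_step1 (abs_base (by norm_num : (0:ℝ) ≤ 18)) hr1) hr1) hr1) hLα) hLα) hLα) hw₁) hw₁) hη₁) hη₁) hη₁))) ?_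
    norm_num
  have hx6 : |g ^ 3| ≤ |g| ^ 3 + |μ| ^ 3 := by
    rw [abs_pow]; linarith [pow_nonneg (abs_nonneg μ) 3]
  have ht6 : |((8 : ℝ) * Lα * ξ * w₀ * η₀ - (4 : ℝ) * Lα * β * γh * w₀ * η₀ * η₀ + (8 : ℝ) * r * Lα * β * w₀ * η₀ * η₁ - (2 : ℝ) * Lα * Lα * ξ * w₁ * η₀ - (2 : ℝ) * r * Lα * Lα * ξ * w₁ * η₁ - (4 : ℝ) * r * Lα * Lα * β * w₁ * η₀ * η₁ + (4 : ℝ) * r * r * Lα * Lα * β * w₁ * η₁ * η₁ - (2 : ℝ) * Lα * Lα * Lα * w₁ * w₁ * η₀ * η₀ * η₀ - (14 : ℝ) * r * Lα * Lα * Lα * w₁ * w₁ * η₀ * η₀ * η₁ + (34 : ℝ) * r * r * Lα * Lα * Lα * w₁ * w₁ * η₀ * η₁ * η₁ - (18 : ℝ) * r * r * r * Lα * Lα * Lα * w₁ * w₁ * η₁ * η₁ * η₁) * (g ^ 3)| ≤ (100 : ℝ) * B ^ 11 * (|g| ^ 3 + |μ| ^ 3) := abs_coef_mul hc6 hx6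
  have hc7 : |(32 : ℝ) * Lα * ξ * w₀ * w₀ * η₀ - (16 : ℝ) * Lα * β * γh * w₀ * w₀ * η₀ * η₀ + (32 : ℝ) * r * Lα * β * w₀ * w₀ * η₀ * η₁ - (8 : ℝ) * Lα * Lα * ξ * w₀ * w₁ * η₀ + (2 : ℝ) * Lα * Lα * β * γh * ξ * w₁ - (8 : ℝ) * r * Lα * Lα * ξ * w₀ * w₁ * η₁ - (16 : ℝ) * r * Lα * Lα * β * w₀ * w₁ * η₀ * η₁ + (4 : ℝ) * r * Lα * Lα * β * β * γh * w₁ * η₁ + (16 : ℝ) * r * r * Lα * Lα * β * w₀ * w₁ * η₁ * η₁ - (8 : ℝ) * Lα * Lα * Lα * w₀ * w₁ * w₁ * η₀ * η₀ * η₀ + (4 : ℝ) * Lα * Lα * Lα * ξ * w₁ * w₁ * η₀ + (2 : ℝ) * Lα * Lα * Lα * β * γh * w₁ * w₁ * η₀ * η₀ - (56 : ℝ) * r * Lα * Lα * Lα * w₀ * w₁ * w₁ * η₀ * η₀ * η₁ + (12 : ℝ) * r * Lα * Lα * Lα * ξ * w₁ * w₁ * η₁ + (8 : ℝ) * r * Lα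 * Lα * Lα * β * w₁ * w₁ * η₀ * η₁ + (12 : ℝ) * r * Lα * Lα * Lα * β * γh * w₁ * w₁ * η₀ * η₁ + (136 : ℝ) * r * r * Lα * Lα * Lα * w₀ * w₁ * w₁ * η₀ * η₁ * η₁ - (8 : ℝ) * r * r * Lα * Lα * Lα * β * w₁ * w₁ * η₁ * η₁ - (14 : ℝ) * r * r * Lα * Lα * Lα * β * γh * w₁ * w₁ * η₁ * η₁ - (72 : ℝ) * r * r * r * Lα * Lα * Lα * w₀ * w₁ * w₁ * η₁ * η₁ * η₁ + (4 : ℝ) * Lα * Lα * Lα * Lα * w₁ * w₁ * w₁ * η₀ * η₀ * η₀ + (36 : ℝ) * r * Lα * Lα * Lα * Lα * w₁ * w₁ * w₁ * η₀ * η₀ * η₁ - (84 : ℝ) * r * r * Lα * Lα * Lα * Lα * w₁ * w₁ * w₁ * η₀ * η₁ * η₁ + (44 : ℝ) * r * r * r * Lα * Lα * Lα * Lα * w₁ * w₁ * w₁ * η₁ * η₁ * η₁| ≤ (634 : ℝ) * B ^ 11 := by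
    refine le_of_le_of_eq (abs_add_le_of (abs_sub_le_of (abs_add_le_of (abs_add_le_of (abs_sub_le_of (abs_sub_le_of (abs_sub_le_of (abs_add_le_of (abs_add_le_of (abs_add_le_of (abs_add_le_of (abs_sub_le_of (abs_add_le_of (abs_add_le_of (abs_sub_le_of (abs_add_le_of (abs_add_le_of (abs_sub_le_of (abs_sub_le_of (abs_add_le_of (abs_sub_le_of (abs_add_le_of (abs_sub_le_of (abs_top hB (by norm_num) (by norm_num : 5 ≤ 11) (abs_step (abs_step (abs_step (abs_step (abs_step (abs_base (by norm_num : (0:ℝ) ≤ 32)) hLα) hξ) hw₀) hw₀) hη₀)) (abs_top hB (by norm_num) (by norm_num : 7 ≤ 11) (abs_step (abs_step (abs_step (abs_step (abs_step (abs_step (abs_step (abs_base (by norm_num : (0:ℝ) ≤ 16)) hLα) hβ) hγ) hw₀) hw₀) hη₀) hη₀))) (abs_top hB (by norm_num) (by norm_num : 6 ≤ 11) (abs_step (abs_step (abs_step (abs_step (abs_step (abs_step (abs_step1 (abs_base (by norm_num : (0:ℝ) ≤ 32)) hr1) hLα) hβ) hw₀) hw₀) hη₀) hη₁))) (abs_top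 hB (by norm_num) (by norm_num : 6 ≤ 11) (abs_step (abs_step (abs_step (abs_step (abs_step (abs_step (abs_base (by norm_num : (0:ℝ) ≤ 8)) hLα) hLα) hξ) hw₀) hw₁) hη₀))) (abs_top hB (by norm_num) (by norm_num : 6 ≤ 11) (abs_step (abs_step (abs_step (abs_step (abs_step (abs_step (abs_base (by norm_num : (0:ℝ) ≤ 2)) hLα) hLα) hβ) hγ) hξ) hw₁))) (abs_top hB (by norm_num) (by norm_num : 6 ≤ 11) (abs_step (abs_step (abs_step (abs_step (abs_step (abs_step (abs_step1 (abs_base (by norm_num : (0:ℝ) ≤ 8)) hr1) hLα) hLα) hξ) hw₀) hw₁) hη₁))) (abs_top hB (by norm_num) (by norm_num : 7 ≤ 11) (abs_step (abs_step (abs_step (abs_step (abs_step (abs_step (abs_step (abs_step1 (abs_base (by norm_num : (0:ℝ) ≤ 16)) hr1) hLα) hLα) hβ) hw₀) hw₁) hη₀) hη₁))) (abs_top hB (by norm_num) (by norm_num : 7 ≤ 11) (abs_step (abs_step (abs_step (abs_step (abs_step (abs_step (abs_step (abs_step1 (abs_base (by norm_num : (0:ℝ) ≤ 4)) hr1) hLα)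 hLα) hβ) hβ) hγ) hw₁) hη₁))) (abs_top hB (by norm_num) (by norm_num : 7 ≤ 11) (abs_step (abs_step (abs_step (abs_step (abs_step (abs_step (abs_step (abs_step1 (abs_step1 (abs_base (by norm_num : (0:ℝ) ≤ 16)) hr1) hr1) hLα) hLα) hβ) hw₀) hw₁) hη₁) hη₁))) (abs_top hB (by norm_num) (by norm_num : 9 ≤ 11) (abs_step (abs_step (abs_step (abs_step (abs_step (abs_step (abs_step (abs_step (abs_step (abs_base (by norm_num : (0:ℝ) ≤ 8)) hLα) hLα) hLα) hw₀) hw₁) hw₁) hη₀) hη₀) hη₀))) (abs_top hB (by norm_num) (by norm_num : 7 ≤ 11) (abs_step (abs_step (abs_step (abs_step (abs_step (abs_step (abs_step (abs_base (by norm_num : (0:ℝ) ≤ 4)) hLα) hLα) hLα) hξ) hw₁) hw₁) hη₀))) (abs_top hB (by norm_num) (by norm_num : 9 ≤ 11) (abs_step (abs_step (abs_step (abs_step (abs_step (abs_step (abs_step (abs_step (abs_step (abs_base (by norm_num : (0:ℝ) ≤ 2)) hLα) hLα) hLα) hβ) hγ) hw₁) hw₁) hη₀) hη₀))) (abs_top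 hB (by norm_num) (by norm_num : 9 ≤ 11) (abs_step (abs_step (abs_step (abs_step (abs_step (abs_step (abs_step (abs_step (abs_step (abs_step1 (abs_base (by norm_num : (0:ℝ) ≤ 56)) hr1) hLα) hLα) hLα) hw₀) hw₁) hw₁) hη₀) hη₀) hη₁))) (abs_top hB (by norm_num) (by norm_num : 7 ≤ 11) (abs_step (abs_step (abs_step (abs_step (abs_step (abs_step (abs_step (abs_step1 (abs_base (by norm_num : (0:ℝ) ≤ 12)) hr1) hLα) hLα) hLα) hξ) hw₁) hw₁) hη₁))) (abs_top hB (by norm_num) (by norm_num : 8 ≤ 11) (abs_step (abs_step (abs_step (abs_step (abs_step (abs_step (abs_step (abs_step (abs_step1 (abs_base (by norm_num : (0:ℝ) ≤ 8)) hr1) hLα) hLα) hLα) hβ) hw₁) hw₁) hη₀) hη₁))) (abs_top hB (by norm_num) (by norm_num : 9 ≤ 11) (abs_step (abs_step (abs_step (abs_step (abs_step (abs_step (abs_step (abs_step (abs_step (abs_step1 (abs_base (by norm_num : (0:ℝ) ≤ 12)) hr1) hLα) hLα) hLα) hβ) hγ) hw₁) hw₁) hη₀) hη₁))) (abs_top hB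 (by norm_num) (by norm_num : 9 ≤ 11) (abs_step (abs_step (abs_step (abs_step (abs_step (abs_step (abs_step (abs_step (abs_step (abs_step1 (abs_step1 (abs_base (by norm_num : (0:ℝ) ≤ 136)) hr1) hr1) hLα) hLα) hLα) hw₀) hw₁) hw₁) hη₀) hη₁) hη₁))) (abs_top hB (by norm_num) (by norm_num : 8 ≤ 11) (abs_step (abs_step (abs_step (abs_step (abs_step (abs_step (abs_step (abs_step (abs_step1 (abs_step1 (abs_base (by norm_num : (0:ℝ) ≤ 8)) hr1) hr1) hLα) hLα) hLα) hβ) hw₁) hw₁) hη₁) hη₁))) (abs_top hB (by norm_num) (by norm_num : 9 ≤ 11) (abs_step (abs_step (abs_step (abs_step (abs_step (abs_step (abs_step (abs_step (abs_step (abs_step1 (abs_step1 (abs_base (by norm_num : (0:ℝ) ≤ 14)) hr1) hr1) hLα) hLα) hLα) hβ) hγ) hw₁) hw₁) hη₁) hη₁))) (abs_top hB (by norm_num) (by norm_num : 9 ≤ 11) (abs_step (abs_step (abs_step (abs_step (abs_step (abs_step (abs_step (abs_step (abs_step (abs_step1 (abs_step1 (abs_step1 (abs_base (by norm_num : (0:ℝ)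 ≤ 72)) hr1) hr1) hr1) hLα) hLα) hLα) hw₀) hw₁) hw₁) hη₁) hη₁) hη₁))) (abs_top hB (by norm_num) (by norm_num : 10 ≤ 11) (abs_step (abs_step (abs_step (abs_step (abs_step (abs_step (abs_step (abs_step (abs_step (abs_step (abs_base (by norm_num : (0:ℝ) ≤ 4)) hLα) hLα) hLα) hLα) hw₁) hw₁) hw₁) hη₀) hη₀) hη₀))) (abs_top hB (by norm_num) (by norm_num : 10 ≤ 11) (abs_step (abs_step (abs_step (abs_step (abs_step (abs_step (abs_step (abs_step (abs_step (abs_step (abs_step1 (abs_base (by norm_num : (0:ℝ) ≤ 36)) hr1) hLα) hLα) hLα) hLα) hw₁) hw₁) hw₁) hη₀) hη₀) hη₁))) (abs_top hB (by norm_num) (by norm_num : 10 ≤ 11) (abs_step (abs_step (abs_step (abs_step (abs_step (abs_step (abs_step (abs_step (abs_step (abs_step (abs_step1 (abs_step1 (abs_base (by norm_num : (0:ℝ) ≤ 84)) hr1) hr1) hLα) hLα) hLα) hLα) hw₁) hw₁) hw₁) hη₀) hη₁) hη₁))) (abs_top hB (by norm_num) (by norm_num : 10 ≤ 11) (abs_step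 (abs_step (abs_step (abs_step (abs_step (abs_step (abs_step (abs_step (abs_step (abs_step (abs_step1 (abs_step1 (abs_step1 (abs_base (by norm_num : (0:ℝ) ≤ 44)) hr1) hr1) hr1) hLα) hLα) hLα) hLα) hw₁) hw₁) hw₁) hη₁) hη₁) hη₁))) ?_
    norm_num
  have hx7 : |g ^ 3 * μ| ≤ |g| ^ 3 + |μ| ^ 3 := by
    simpa using abs_pow_mul_pow_le_cube hg hμ (i := 3) (k := 1) (by norm_num)
  have ht7 : |((32 : ℝ) * Lα * ξ * w₀ * w₀ * η₀ - (16 : ℝ) * Lα * β * γh * w₀ * w₀ * η₀ * η₀ + (32 : ℝ) * r * Lα * β * w₀ * w₀ * η₀ * η₁ - (8 : ℝ) * Lα * Lα * ξ * w₀ * w₁ * η₀ + (2 : ℝ) * Lα * Lα * β * γh * ξ * w₁ - (8 : ℝ) * r * Lα * Lα * ξ * w₀ * w₁ * η₁ - (16 : ℝ) * r * Lα * Lα * β * w₀ * w₁ * η₀ * η₁ + (4 : ℝ) * r * Lα * Lα * β * β * γh * w₁ * η₁ + (16 : ℝ) * r * r * Lα * Lα * β * w₀ * w₁ * η₁ *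 η₁ - (8 : ℝ) * Lα * Lα * Lα * w₀ * w₁ * w₁ * η₀ * η₀ * η₀ + (4 : ℝ) * Lα * Lα * Lα * ξ * w₁ * w₁ * η₀ + (2 : ℝ) * Lα * Lα * Lα * β * γh * w₁ * w₁ * η₀ * η₀ - (56 : ℝ) * r * Lα * Lα * Lα * w₀ * w₁ * w₁ * η₀ * η₀ * η₁ + (12 : ℝ) * r * Lα * Lα * Lα * ξ * w₁ * w₁ * η₁ + (8 : ℝ) * r * Lα * Lα * Lα * β * w₁ * w₁ * η₀ * η₁ + (12 : ℝ) * r * Lα * Lα * Lα * β * γh * w₁ * w₁ * η₀ * η₁ + (136 : ℝ) * r * r * Lα * Lα * Lα * w₀ * w₁ * w₁ * η₀ * η₁ * η₁ - (8 : ℝ) * r * r * Lα * Lα * Lα * β * w₁ * w₁ * η₁ * η₁ - (14 : ℝ) * r * r * Lα * Lα * Lα * β * γh * w₁ * w₁ * η₁ * η₁ - (72 : ℝ) * r * r * r * Lα * Lα * Lα * w₀ * w₁ * w₁ * η₁ * η₁ * η₁ + (4 : ℝ) * Lα * Lα * Lα * Lα * w₁ * w₁ * w₁ * η₀ * η₀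 * η₀ + (36 : ℝ) * r * Lα * Lα * Lα * Lα * w₁ * w₁ * w₁ * η₀ * η₀ * η₁ - (84 : ℝ) * r * r * Lα * Lα * Lα * Lα * w₁ * w₁ * w₁ * η₀ * η₁ * η₁ + (44 : ℝ) * r * r * r * Lα * Lα * Lα * Lα * w₁ * w₁ * w₁ * η₁ * η₁ * η₁) * (g ^ 3 * μ)| ≤ (634 : ℝ) * B ^ 11 * (|g| ^ 3 + |μ| ^ 3) := abs_coef_mul hc7 hx7
  have hc8 : |(16 : ℝ) * Lα * ξ * w₀ * w₀ * η₀ * η₀ - (16 : ℝ) * Lα * β * γh * w₀ * w₀ * η₀ * η₀ * η₀ + (16 : ℝ) * r * Lα * β * w₀ * w₀ * η₀ * η₀ * η₁ + (1 : ℝ) * Lα * Lα * ξ * ξ * w₁ + (4 : ℝ) * r * Lα * Lα * β * ξ * w₁ * η₁ + (2 : ℝ) * Lα * Lα * Lα * ξ * w₁ * w₁ * η₀ * η₀ + (12 : ℝ) * r * Lα * Lα * Lα * ξ * w₁ * w₁ * η₀ * η₁ + (4 : ℝ) * r * Lα * Lα * Lα * β * w₁ * w₁ * η₀ * η₀ *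 η₁ - (14 : ℝ) * r * r * Lα * Lα * Lα * ξ * w₁ * w₁ * η₁ * η₁ - (8 : ℝ) * r * r * Lα * Lα * Lα * β * w₁ * w₁ * η₀ * η₁ * η₁ + (4 : ℝ) * r * r * r * Lα * Lα * Lα * β * w₁ * w₁ * η₁ * η₁ * η₁ + (1 : ℝ) * Lα * Lα * Lα * Lα * w₁ * w₁ * w₁ * η₀ * η₀ * η₀ * η₀ + (12 : ℝ) * r * Lα * Lα * Lα * Lα * w₁ * w₁ * w₁ * η₀ * η₀ * η₀ * η₁ - (42 : ℝ) * r * r * Lα * Lα * Lα * Lα * w₁ * w₁ * w₁ * η₀ * η₀ * η₁ * η₁ + (44 : ℝ) * r * r * r * Lα * Lα * Lα * Lα * w₁ * w₁ * w₁ * η₀ * η₁ * η₁ * η₁ - (15 : ℝ) * r * r * r * r * Lα * Lα * Lα * Lα * w₁ * w₁ * w₁ * η₁ * η₁ * η₁ * η₁| ≤ (211 : ℝ) * B ^ 11 := by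
    refine le_of_le_of_eq (abs_sub_le_of (abs_add_le_of (abs_sub_le_of (abs_add_le_of (abs_add_le_of (abs_add_le_of (abs_sub_le_of (abs_sub_le_of (abs_add_le_of (abs_add_le_of (abs_add_le_of (abs_add_le_of (abs_add_le_of (abs_add_le_of (abs_sub_le_of (abs_top hB (by norm_num) (by norm_num : 6 ≤ 11) (abs_step (abs_step (abs_step (abs_step (abs_step (abs_step (abs_base (by norm_num : (0:ℝ) ≤ 16)) hLα) hξ) hw₀) hw₀) hη₀) hη₀)) (abs_top hB (by norm_num) (by norm_num : 8 ≤ 11) (abs_step (abs_step (abs_step (abs_step (abs_step (abs_step (abs_step (abs_step (abs_base (by norm_num : (0:ℝ) ≤ 16)) hLα) hβ) hγ) hw₀) hw₀) hη₀) hη₀) hη₀))) (abs_top hB (by norm_num) (by norm_num : 7 ≤ 11) (abs_step (abs_step (abs_step (abs_step (abs_step (abs_step (abs_step (abs_step1 (abs_base (by norm_num : (0:ℝ) ≤ 16)) hr1) hLα) hβ) hw₀) hw₀) hη₀) hη₀) hη₁))) (abs_top hB (by norm_num) (by norm_num : 5 ≤ 11) (abs_step (abs_step (abs_step (abs_step (abs_step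 (abs_base (by norm_num : (0:ℝ) ≤ 1)) hLα) hLα) hξ) hξ) hw₁))) (abs_top hB (by norm_num) (by norm_num : 6 ≤ 11) (abs_step (abs_step (abs_step (abs_step (abs_step (abs_step (abs_step1 (abs_base (by norm_num : (0:ℝ) ≤ 4)) hr1) hLα) hLα) hβ) hξ) hw₁) hη₁))) (abs_top hB (by norm_num) (by norm_num : 8 ≤ 11) (abs_step (abs_step (abs_step (abs_step (abs_step (abs_step (abs_step (abs_step (abs_base (by norm_num : (0:ℝ) ≤ 2)) hLα) hLα) hLα) hξ) hw₁) hw₁) hη₀) hη₀))) (abs_top hB (by norm_num) (by norm_num : 8 ≤ 11) (abs_step (abs_step (abs_step (abs_step (abs_step (abs_step (abs_step (abs_step (abs_step1 (abs_base (by norm_num : (0:ℝ) ≤ 12)) hr1) hLα) hLα) hLα) hξ) hw₁) hw₁) hη₀) hη₁))) (abs_top hB (by norm_num) (by norm_num : 9 ≤ 11) (abs_step (abs_step (abs_step (abs_step (abs_step (abs_step (abs_step (abs_step (abs_step (abs_step1 (abs_base (by norm_num : (0:ℝ) ≤ 4)) hr1) hLα) hLα) hLα) hβ) hw₁) hw₁)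 hη₀) hη₀) hη₁))) (abs_top hB (by norm_num) (by norm_num : 8 ≤ 11) (abs_step (abs_step (abs_step (abs_step (abs_step (abs_step (abs_step (abs_step (abs_step1 (abs_step1 (abs_base (by norm_num : (0:ℝ) ≤ 14)) hr1) hr1) hLα) hLα) hLα) hξ) hw₁) hw₁) hη₁) hη₁))) (abs_top hB (by norm_num) (by norm_num : 9 ≤ 11) (abs_step (abs_step (abs_step (abs_step (abs_step (abs_step (abs_step (abs_step (abs_step (abs_step1 (abs_step1 (abs_base (by norm_num : (0:ℝ) ≤ 8)) hr1) hr1) hLα) hLα) hLα) hβ) hw₁) hw₁) hη₀) hη₁) hη₁))) (abs_top hB (by norm_num) (by norm_num : 9 ≤ 11) (abs_step (abs_step (abs_step (abs_step (abs_step (abs_step (abs_step (abs_step (abs_step (abs_step1 (abs_step1 (abs_step1 (abs_base (by norm_num : (0:ℝ) ≤ 4)) hr1) hr1) hr1) hLα) hLα) hLα) hβ) hw₁) hw₁) hη₁) hη₁) hη₁))) (abs_top hB (by norm_num) (by norm_num : 11 ≤ 11) (abs_step (abs_step (abs_step (abs_step (abs_step (abs_step (abs_step (abs_step (abs_step (abs_step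 (abs_step (abs_base (by norm_num : (0:ℝ) ≤ 1)) hLα) hLα) hLα) hLα) hw₁) hw₁) hw₁) hη₀) hη₀) hη₀) hη₀))) (abs_top hB (by norm_num) (by norm_num : 11 ≤ 11) (abs_step (abs_step (abs_step (abs_step (abs_step (abs_step (abs_step (abs_step (abs_step (abs_step (abs_step (abs_step1 (abs_base (by norm_num : (0:ℝ) ≤ 12)) hr1) hLα) hLα) hLα) hLα) hw₁) hw₁) hw₁) hη₀) hη₀) hη₀) hη₁))) (abs_top hB (by norm_num) (by norm_num : 11 ≤ 11) (abs_step (abs_step (abs_step (abs_step (abs_step (abs_step (abs_step (abs_step (abs_step (abs_step (abs_step (abs_step1 (abs_step1 (abs_base (by norm_num : (0:ℝ) ≤ 42)) hr1) hr1) hLα) hLα) hLα) hLα) hw₁) hw₁) hw₁) hη₀) hη₀) hη₁) hη₁))) (abs_top hB (by norm_num) (by norm_num : 11 ≤ 11) (abs_step (abs_step (abs_step (abs_step (abs_step (abs_step (abs_step (abs_step (abs_step (abs_step (abs_step (abs_step1 (abs_step1 (abs_step1 (abs_base (by norm_num : (0:ℝ) ≤ 44)) hr1) hr1) hr1) hLα)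 hLα) hLα) hLα) hw₁) hw₁) hw₁) hη₀) hη₁) hη₁) hη₁))) (abs_top hB (by norm_num) (by norm_num : 11 ≤ 11) (abs_step (abs_step (abs_step (abs_step (abs_step (abs_step (abs_step (abs_step (abs_step (abs_step (abs_step (abs_step1 (abs_step1 (abs_step1 (abs_step1 (abs_base (by norm_num : (0:ℝ) ≤ 15)) hr1) hr1) hr1) hr1) hLα) hLα) hLα) hLα) hw₁) hw₁) hw₁) hη₁) hη₁) hη₁) hη₁))) ?_
    norm_num
  have hx8 : |g ^ 4| ≤ |g| ^ 3 + |μ| ^ 3 := by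
    simpa using abs_pow_mul_pow_le_cube hg hμ (i := 4) (k := 0) (by norm_num)
  have ht8 : |((16 : ℝ) * Lα * ξ * w₀ * w₀ * η₀ * η₀ - (16 : ℝ) * Lα * β * γh * w₀ * w₀ * η₀ * η₀ * η₀ + (16 : ℝ) * r * Lα * β * w₀ * w₀ * η₀ * η₀ * η₁ + (1 : ℝ) * Lα * Lα * ξ * ξ * w₁ + (4 : ℝ) * r * Lα * Lα * β * ξ * w₁ * η₁ + (2 : ℝ) * Lα * Lα * Lα * ξ * w₁ * w₁ * η₀ * η₀ + (12 : ℝ) * r * Lα * Lα * Lα * ξ * w₁ * w₁ * η₀ * η₁ + (4 : ℝ) * r * Lα * Lα * Lα * β * w₁ * w₁ * η₀ * η₀ * η₁ - (14 : ℝ) * r * r * Lα * Lα * Lα * ξ * w₁ * w₁ * η₁ * η₁ - (8 : ℝ) * r * r * Lα * Lα * Lα * β * w₁ * w₁ * η₀ * η₁ * η₁ + (4 : ℝ) * r * r * r * Lα * Lα * Lα * β * w₁ * w₁ * η₁ * η₁ * η₁ + (1 : ℝ) * Lα * Lα * Lα * Lα * w₁ * w₁ * w₁ * η₀ * η₀ *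 η₀ * η₀ + (12 : ℝ) * r * Lα * Lα * Lα * Lα * w₁ * w₁ * w₁ * η₀ * η₀ * η₀ * η₁ - (42 : ℝ) * r * r * Lα * Lα * Lα * Lα * w₁ * w₁ * w₁ * η₀ * η₀ * η₁ * η₁ + (44 : ℝ) * r * r * r * Lα * Lα * Lα * Lα * w₁ * w₁ * w₁ * η₀ * η₁ * η₁ * η₁ - (15 : ℝ) * r * r * r * r * Lα * Lα * Lα * Lα * w₁ * w₁ * w₁ * η₁ * η₁ * η₁ * η₁) * (g ^ 4)| ≤ (211 : ℝ) * B ^ 11 * (|g| ^ 3 + |μ| ^ 3) := abs_coef_mul hc8 hx8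
  refine le_of_le_of_eq (abs_add_le_of (abs_add_le_of (abs_add_le_of (abs_add_le_of (abs_add_le_of (abs_add_le_of (abs_add_le_of (abs_add_le_of (ht0) ht1) ht2) ht3) ht4) ht5) ht6) ht7) ht8) ?_
  ring

/-! ### The factor `L^ε - 1 = O(ε)` -/

/-- For `L ≥ 1`, `ε ≥ 0`: `0 ≤ L^ε - 1`. [folklore] -/
theorem rpow_sub_one_nonneg {L ε : ℝ} (hL : 1 ≤ L) (hε : 0 ≤ ε) : 0 ≤ L ^ ε - 1 :=
  sub_nonneg.2 (Real.one_le_rpow hL hε)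

/-- For `L > 0` and any real `ε`: `L^ε - 1 ≤ εL^ε log L` (the tangent inequality `e^{-t} ≥ 1 - t`
at `t = ε log L`). This is how the `ε` of the error term `O(|s|²ε)` of Proposition 5.3.1 arises
from the factor `L^ε - 1` of `Slade2017_prop531_fst` ("the last term on the right-hand side is
`O(ε)`", with an `L`-dependent constant, `L` being fixed before `ε`).
[cite: Slade2017, proof of Proposition 5.3.1 (last two displays)] -/
theorem rpow_sub_one_le {L : ℝ} (hL : 0 < L) (ε : ℝ) : L ^ ε - 1 ≤ ε * L ^ ε * Real.log L := by
  have h1 : -(ε * Real.log L) + 1 ≤ Real.exp (-(ε * Real.log L)) := Real.add_one_le_exp _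
  have h2 : L ^ ε = Real.exp (ε * Real.log L) := by rw [Real.rpow_def_of_pos hL, mul_comm]
  have h3 : Real.exp (ε * Real.log L) * Real.exp (-(ε * Real.log L)) = 1 := by
    rw [← Real.exp_add, add_neg_cancel, Real.exp_zero]
  have hpos : 0 < Real.exp (ε * Real.log L) := Real.exp_pos _
  have h4 := mul_le_mul_of_nonneg_left h1 hpos.le
  rw [h3] at h4
  rw [h2]
  linarith

/-! ### §5.4: the perturbative fixed point `s̄` and the `ȳ`-recursion -/

/-- The perturbative fixed point `s̄ = a⁻¹(1 - L^{-ε})` of §5.4 (arguments `a`, `Lε = L^ε`;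
`a = lim_j β_j(0)` of Lemma 5.2.2). [cite: Slade2017, §5.4 (display defining `s̄`)] -/
def sbar (a Lε : ℝ) : ℝ := (1 - Lε⁻¹) / a

/-- `a s̄ = 1 - L^{-ε}`. [cite: Slade2017, §5.4 (display defining `s̄`)] -/
theorem Slade2017_mul_sbar {a : ℝ} (ha : a ≠ 0) (Lε : ℝ) : a * sbar a Lε = 1 - Lε⁻¹ := by
  unfold sbar; field_simp

/-- Equivalent form of the fixed point equation used in the `ȳ`-recursion: `L^ε a s̄ = L^ε - 1`.
[cite: Slade2017, §5.4] -/
theorem Slade2017_sbar_mul {a Lε : ℝ} (ha : a ≠ 0) (hL : Lε ≠ 0) :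
    Lε * a * sbar a Lε = Lε - 1 := by
  rw [mul_assoc, Slade2017_mul_sbar ha, mul_sub, mul_one, mul_inv_cancel₀ hL]

/-- **§5.4**: `s̄` solves the perturbative fixed point equation `s̄ = L^ε s̄(1 - as̄)` (the massless
`β^:_j` replaced by its limiting value `a`). [cite: Slade2017, §5.4 (the two displays defining `s̄`)] -/
theorem Slade2017_sbar_fixedPoint {a Lε : ℝ} (ha : a ≠ 0) (hL : Lε ≠ 0) :
    Lε * sbar a Lε * (1 - a * sbar a Lε) = sbar a Lε := by
  have h := Slade2017_sbar_mul ha hL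
  linear_combination (-(sbar a Lε)) * h

/-- **§5.4**: `s̄` is "the nonzero solution" — any `s ≠ 0` with `s = L^ε s(1 - as)` equals `s̄`.
[cite: Slade2017, §5.4] -/
theorem Slade2017_sbar_unique {a Lε s : ℝ} (ha : a ≠ 0) (hs : s ≠ 0)
    (h : Lε * s * (1 - a * s) = s) : s = sbar a Lε := by
  have h1 : Lε * (1 - a * s) = 1 := by
    have h' : s * (Lε * (1 - a * s)) = s * 1 := by rw [mul_one]; linear_combination h
    exact mul_left_cancel₀ hs h'
  have h2 : Lε⁻¹ = 1 - a * s := inv_eq_of_mul_eq_one_right h1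
  unfold sbar
  rw [eq_div_iff ha, h2]; ring

/-- **§5.4, `s̄ = O(ε)`**: for `L > 0`, `a > 0` and any `ε`, `a s̄ = 1 - L^{-ε} ≤ ε log L`
(tangent inequality for the exponential). [cite: Slade2017, §5.4 ("`s̄ = a⁻¹(1-L^{-ε}) = O(ε)`")] -/
theorem Slade2017_sbar_le {a L : ℝ} (ha : 0 < a) (hL : 0 < L) (ε : ℝ) :
    a * sbar a (L ^ ε) ≤ ε * Real.log L := by
  rw [Slade2017_mul_sbar ha.ne', ← Real.rpow_neg hL.le]
  have h1 : -(ε * Real.log L) + 1 ≤ Real.exp (-(ε * Real.log L)) := Real.add_one_le_exp _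
  have h2 : L ^ (-ε) = Real.exp (-(ε * Real.log L)) := by
    rw [Real.rpow_def_of_pos hL]; ring_nf
  linarith

/-- **§5.4, "`as̄ ∼ ε log L` as `ε ↓ 0`"**, lower half: `εL^{-ε} log L ≤ a s̄` (from `e^t ≥ 1 + t`
at `t = ε log L`); with `Slade2017_sbar_le` this pins `as̄/(ε log L) ∈ [L^{-ε}, 1]`.
[cite: Slade2017, §5.4 (display "`as̄ ∼ ε log L`")] -/
theorem Slade2017_le_sbar {a L : ℝ} (ha : 0 < a) (hL : 0 < L) (ε : ℝ) :
    ε * Real.log L * L ^ (-ε) ≤ a * sbar a (L ^ ε) := by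
  rw [Slade2017_mul_sbar ha.ne', ← Real.rpow_neg hL.le]
  have h1 : ε * Real.log L + 1 ≤ Real.exp (ε * Real.log L) := Real.add_one_le_exp _
  have h2 : L ^ (-ε) = Real.exp (-(ε * Real.log L)) := by
    rw [Real.rpow_def_of_pos hL]; ring_nf
  have h3 : Real.exp (ε * Real.log L) * Real.exp (-(ε * Real.log L)) = 1 := by
    rw [← Real.exp_add, add_neg_cancel, Real.exp_zero]
  have hpos : 0 < Real.exp (-(ε * Real.log L)) := Real.exp_pos _
  have h4 := mul_le_mul_of_nonneg_right h1 hpos.le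
  rw [h3] at h4
  rw [h2]
  linarith

/-- **§5.4**: `0 < s̄` when `a > 0`, `L > 1`, `ε > 0`. [cite: Slade2017, §5.4] -/
theorem Slade2017_sbar_pos {a L ε : ℝ} (ha : 0 < a) (hL : 1 < L) (hε : 0 < ε) :
    0 < sbar a (L ^ ε) := by
  have h1 : 1 < L ^ ε := Real.one_lt_rpow hL hε
  unfold sbar
  exact div_pos (sub_pos.2 (inv_lt_one_of_one_lt₀ h1)) ha

/-- **§5.4, the `ȳ`-recursion (first display "(5.4.0)")**: with `ȳ_j = s̄ - s̄_j` and
`s̄_{j+1} = L^ε s̄_j(1 - β^:_j s̄_j)` (`barFlowS`), the fixed point relation `L^ε a s̄ = L^ε - 1`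
(`Slade2017_sbar_mul`) gives
`ȳ_{j+1} = c_ε ȳ_j + L^ε(aȳ_j² + (β^:_j - a)(s̄ - ȳ_j)²)`, `c_ε = 2 - L^ε`.
[cite: Slade2017, §5.4 (display "(5.4.0)", first line, and the display defining `c_ε`)] -/
theorem Slade2017_ybar_recursion {Lε a sb : ℝ} (hfix : Lε * a * sb = Lε - 1) (βW y : ℝ) :
    sb - barFlowS Lε βW (sb - y) = (2 - Lε) * y + Lε * (a * y ^ 2 + (βW - a) * (sb - y) ^ 2) := by
  unfold barFlowS
  linear_combination (sb - 2 * y) * hfix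

/-- `c_ε = 2 - L^ε = 1 - x` with `x = L^ε - 1 > 0` for `L > 1`, `ε > 0`, so `c_ε < 1` — "this
coefficient `c_ε` is responsible for contraction of the sequence `y_j`" (§7.1); and
`x ≤ εL^ε log L` (`rpow_sub_one_le`), i.e. `x ∼ ε log L`. [cite: Slade2017, §5.4 (display defining `c_ε`)] -/
theorem Slade2017_cEps_lt_one {L ε : ℝ} (hL : 1 < L) (hε : 0 < ε) : 2 - L ^ ε < 1 := by
  have h1 : 1 < L ^ ε := Real.one_lt_rpow hL hε
  linarith

/-- `1 - c_ε = L^ε - 1 ≤ εL^ε log L` (`x ∼ ε log L` as `ε ↓ 0`, upper half).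
[cite: Slade2017, §5.4 (display defining `c_ε`)] -/
theorem Slade2017_one_sub_cEps_le {L : ℝ} (hL : 0 < L) (ε : ℝ) :
    1 - (2 - L ^ ε) ≤ ε * L ^ ε * Real.log L := by
  have := rpow_sub_one_le hL ε
  linarith

/-- **§7.1, the second-order part of the `μ`-equation**: `Φ̄_j` written as
`μ̄_{j+1} = L^α μ̄_j + ρ_{μ,j}`, `ρ_{μ,j} = -L^α(γ̂β_jμ̄_j(s̄ - ȳ_j) + ξ^W_j(s̄ - ȳ_j)²)` ("in
particular, `ρ_{μ,j}` is second order"). [cite: Slade2017, §7.1 (display defining `c_ε`, `ρ_{μ,j}`)] -/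
theorem barFlowM_eq_linear_add_rho (Lα γh β ξW sb y μ : ℝ) :
    barFlowM Lα γh β ξW (sb - y) μ =
      Lα * μ + -(Lα * (γh * β * μ * (sb - y) + ξW * (sb - y) ^ 2)) := by
  unfold barFlowM; ring


/-! ### Increments of `T_j`, an a-priori inverse bound, and the flow equations of Lemma 7.1.1 -/

/-- **Increment of `T_j`, `s`-component**: for `|ĝ|, |μ̂|, |a|, |b| ≤ 1` and `|η_{≥j}|, |w̄_j^{(1)}| ≤ B`,
`|T_j(ĝ+a, μ̂+b)_s - T_j(ĝ,μ̂)_s| ≤ 21B²(|a| + |b|)`. This is how the third-order remainders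
`r_{g,j}, r_{ν,j}` of the renormalisation-group map enter `r_{y,j}` in Lemma 7.1.1.
[cite: Slade2017, §5.3 (definition of `T_j`), Lemma 7.1.1] -/
theorem cvS_add_sub_cvS_le {η w g μ a b B : ℝ} (hB : 1 ≤ B) (hη : |η| ≤ B) (hw : |w| ≤ B)
    (hg : |g| ≤ 1) (hμ : |μ| ≤ 1) (ha : |a| ≤ 1) (hb : |b| ≤ 1) :
    |cvS η w (g + a) (μ + b) - cvS η w g μ| ≤ 21 * B ^ 2 * (|a| + |b|) := by
  have hid : cvS η w (g + a) (μ + b) - cvS η w g μ =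
      a * ((1 : ℝ) + (4 : ℝ) * w * μ + (8 : ℝ) * η * w * g + (4 : ℝ) * w * b + (4 : ℝ) * η * w * a) + b * ((4 : ℝ) * w * g) := by
    unfold cvS; ring
  rw [hid]
  have hA : |(1 : ℝ) + (4 : ℝ) * w * μ + (8 : ℝ) * η * w * g + (4 : ℝ) * w * b + (4 : ℝ) * η * w * a| ≤ (21 : ℝ) * B ^ 2 := by
    refine le_of_le_of_eq (abs_add_le_of (abs_add_le_of (abs_add_le_of (abs_add_le_of (abs_top hB (by norm_num) (by norm_num : 0 ≤ 2) (abs_base (by norm_num : (0:ℝ) ≤ 1))) (abs_step1 (abs_top hB (by norm_num) (by norm_num : 1 ≤ 2) (abs_step (abs_base (by norm_num : (0:ℝ) ≤ 4)) hw)) hμ)) (abs_step1 (abs_top hB (by norm_num) (by norm_num : 2 ≤ 2) (abs_step (abs_step (abs_base (by norm_num : (0:ℝ) ≤ 8)) hη) hw)) hg)) (abs_step1 (abs_top hB (by norm_num) (by norm_num : 1 ≤ 2) (abs_step (abs_base (by norm_num : (0:ℝ) ≤ 4)) hw)) hb)) (abs_step1 (abs_top hB (by norm_num) (by norm_num : 2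 ≤ 2) (abs_step (abs_step (abs_base (by norm_num : (0:ℝ) ≤ 4)) hη) hw)) ha)) ?_
    norm_num
  have hB' : |(4 : ℝ) * w * g| ≤ (4 : ℝ) * B ^ 2 := by
    refine le_of_le_of_eq (abs_step1 (abs_top hB (by norm_num) (by norm_num : 1 ≤ 2) (abs_step (abs_base (by norm_num : (0:ℝ) ≤ 4)) hw)) hg) ?_
    norm_num
  have h1 := abs_coef_mul (le_refl |a|) hA
  have h2 := abs_coef_mul (le_refl |b|) hB'
  have hb0 : 0 ≤ |b| * B ^ 2 := by positivity
  calc _ ≤ |a| * (21 * B ^ 2) + |b| * (4 * B ^ 2) := (abs_add_le _ _).trans (add_le_add h1 h2)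
    _ = (21 * |a| + 4 * |b|) * B ^ 2 := by ring
    _ ≤ (21 * |a| + 21 * |b|) * B ^ 2 := by nlinarith [abs_nonneg b]
    _ = 21 * B ^ 2 * (|a| + |b|) := by ring

/-- **Increment of `T_j`, `μ`-component**: for `|ĝ|, |μ̂|, |b| ≤ 1` (and any `a`) and `|η_{≥j}|, |w̄_j^{(1)}| ≤ B`,
`|T_j(ĝ+a, μ̂+b)_μ - T_j(ĝ,μ̂)_μ| ≤ 9B²(|a| + |b|)`.
[cite: Slade2017, §5.3 (definition of `T_j`), Lemma 7.1.1] -/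
theorem cvM_add_sub_cvM_le {η w g μ a b B : ℝ} (hB : 1 ≤ B) (hη : |η| ≤ B) (hw : |w| ≤ B)
    (hg : |g| ≤ 1) (hμ : |μ| ≤ 1) (hb : |b| ≤ 1) :
    |cvM η w (g + a) (μ + b) - cvM η w g μ| ≤ 9 * B ^ 2 * (|a| + |b|) := by
  have hid : cvM η w (g + a) (μ + b) - cvM η w g μ =
      a * ((1 : ℝ) * η + (4 : ℝ) * η * w * μ + (4 : ℝ) * η * w * b) + b * ((1 : ℝ) + (2 : ℝ) * w * μ + (4 : ℝ) * η * w * g + (1 : ℝ) * w * b) := by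
    unfold cvM; ring
  rw [hid]
  have hA : |(1 : ℝ) * η + (4 : ℝ) * η * w * μ + (4 : ℝ) * η * w * b| ≤ (9 : ℝ) * B ^ 2 := by
    refine le_of_le_of_eq (abs_add_le_of (abs_add_le_of (abs_top hB (by norm_num) (by norm_num : 1 ≤ 2) (abs_step (abs_base (by norm_num : (0:ℝ) ≤ 1)) hη)) (abs_step1 (abs_top hB (by norm_num) (by norm_num : 2 ≤ 2) (abs_step (abs_step (abs_base (by norm_num : (0:ℝ) ≤ 4)) hη) hw)) hμ)) (abs_step1 (abs_top hB (by norm_num) (by norm_num : 2 ≤ 2) (abs_step (abs_step (abs_base (by norm_num : (0:ℝ) ≤ 4)) hη) hw)) hb)) ?_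
    norm_num
  have hB' : |(1 : ℝ) + (2 : ℝ) * w * μ + (4 : ℝ) * η * w * g + (1 : ℝ) * w * b| ≤ (8 : ℝ) * B ^ 2 := by
    refine le_of_le_of_eq (abs_add_le_of (abs_add_le_of (abs_add_le_of (abs_top hB (by norm_num) (by norm_num : 0 ≤ 2) (abs_base (by norm_num : (0:ℝ) ≤ 1))) (abs_step1 (abs_top hB (by norm_num) (by norm_num : 1 ≤ 2) (abs_step (abs_base (by norm_num : (0:ℝ) ≤ 2)) hw)) hμ)) (abs_step1 (abs_top hB (by norm_num) (by norm_num : 2 ≤ 2) (abs_step (abs_step (abs_base (by norm_num : (0:ℝ) ≤ 4)) hη) hw)) hg)) (abs_step1 (abs_top hB (by norm_num) (by norm_num : 1 ≤ 2) (abs_step (abs_base (by norm_num : (0:ℝ) ≤ 1)) hw)) hb)) ?_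
    norm_num
  have h1 := abs_coef_mul (le_refl |a|) hA
  have h2 := abs_coef_mul (le_refl |b|) hB'
  have ha0 : 0 ≤ |a| * B ^ 2 := by positivity
  have hb0 : 0 ≤ |b| * B ^ 2 := by positivity
  calc _ ≤ |a| * (9 * B ^ 2) + |b| * (8 * B ^ 2) := (abs_add_le _ _).trans (add_le_add h1 h2)
    _ = (9 * |a| + 8 * |b|) * B ^ 2 := by ring
    _ ≤ (9 * |a| + 9 * |b|) * B ^ 2 := by nlinarith [abs_nonneg b]
    _ = 9 * B ^ 2 * (|a| + |b|) := by ring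

/-- The quadratic part of `T_j`, `s`-component, is quadratically small: for `|ĝ|, |μ̂| ≤ ρ` and
`|ĝ| ≤ M`: `|T_j(ĝ,μ̂)_s - ĝ| ≤ 8B²ρM`.
[cite: Slade2017, §5.3 (display after the definition of `T_j`: "`T_j(ĝ,μ̂) = (ĝ, μ̂+η_{≥j}ĝ) + O(|ĝ|²+|μ̂|²)`")] -/
theorem abs_cvS_sub_le {η w g μ B ρ M : ℝ} (hB : 1 ≤ B) (hη : |η| ≤ B) (hw : |w| ≤ B)
    (hgρ : |g| ≤ ρ) (hμρ : |μ| ≤ ρ) (hgM : |g| ≤ M) :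
    |cvS η w g μ - g| ≤ 8 * B ^ 2 * ρ * M := by
  have hid : cvS η w g μ - g = (4 : ℝ) * w * μ * g + (4 : ℝ) * η * w * g * g := by unfold cvS; ring
  rw [hid]
  refine le_of_le_of_eq (abs_add_le_of (abs_coef_mul (abs_coef_mul (abs_top hB (by norm_num) (by norm_num : 1 ≤ 2) (abs_step (abs_base (by norm_num : (0:ℝ) ≤ 4)) hw)) hμρ) hgM) (abs_coef_mul (abs_coef_mul (abs_top hB (by norm_num) (by norm_num : 2 ≤ 2) (abs_step (abs_step (abs_base (by norm_num : (0:ℝ) ≤ 4)) hη) hw)) hgρ) hgM)) ?_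
  ring

/-- The quadratic part of `T_j`, `μ`-component: `|T_j(ĝ,μ̂)_μ - (μ̂ + η_{≥j}ĝ)| ≤ 5B²ρM` for
`|μ̂| ≤ ρ`, `|ĝ|, |μ̂| ≤ M`. [cite: Slade2017, §5.3 (display after the definition of `T_j`)] -/
theorem abs_cvM_sub_le {η w g μ B ρ M : ℝ} (hB : 1 ≤ B) (hη : |η| ≤ B) (hw : |w| ≤ B)
    (hμρ : |μ| ≤ ρ) (hgM : |g| ≤ M) (hμM : |μ| ≤ M) :
    |cvM η w g μ - μ - η * g| ≤ 5 * B ^ 2 * ρ * M := by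
  have hid : cvM η w g μ - μ - η * g = (1 : ℝ) * w * μ * μ + (4 : ℝ) * η * w * μ * g := by unfold cvM; ring
  rw [hid]
  refine le_of_le_of_eq (abs_add_le_of (abs_coef_mul (abs_coef_mul (abs_top hB (by norm_num) (by norm_num : 1 ≤ 2) (abs_step (abs_base (by norm_num : (0:ℝ) ≤ 1)) hw)) hμρ) hμM) (abs_coef_mul (abs_coef_mul (abs_top hB (by norm_num) (by norm_num : 2 ≤ 2) (abs_step (abs_step (abs_base (by norm_num : (0:ℝ) ≤ 4)) hη) hw)) hμρ) hgM)) ?_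
  ring

/-- **A-priori bound for `T_j⁻¹`** ("`T_j⁻¹(s,μ) = (s, μ - η_{≥j}s) + O(|s|²+|μ|²)` on a
`j`-independent ball", a-priori form): if `|ĝ|, |μ̂| ≤ ρ ≤ 1/(42B³)` then
`max(|ĝ|,|μ̂|) ≤ 2(1+B)(|s| + |μ|)`, `(s,μ) = T_j(ĝ,μ̂)`. In the flow of §7 the running
`(ĝ_j, μ̂_j)` is `O(s̄)`-small, and this converts `O(|ĝ_j|³ + |μ̂_j|³)` into `O(|s_j|³ + |μ_j|³)`.
[cite: Slade2017, Proposition 5.3.1 (existence of `T_j⁻¹` on a `j`-independent ball `B`)] -/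
theorem Slade2017_changeVar_apriori {η w g μ B ρ : ℝ} (hB : 1 ≤ B) (hη : |η| ≤ B) (hw : |w| ≤ B)
    (hρ : ρ ≤ 1 / (42 * B ^ 3)) (hg : |g| ≤ ρ) (hμ : |μ| ≤ ρ) :
    max |g| |μ| ≤ 2 * (1 + B) * (|cvS η w g μ| + |cvM η w g μ|) := by
  set M := max |g| |μ| with hM
  have hB0 : 0 ≤ B := zero_le_one.trans hB
  have hgM : |g| ≤ M := le_max_left _ _
  have hμM : |μ| ≤ M := le_max_right _ _
  have hM0 : 0 ≤ M := (abs_nonneg g).trans hgM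
  have hρ0 : 0 ≤ ρ := (abs_nonneg g).trans hg
  have hQs := abs_cvS_sub_le hB hη hw hg hμ hgM
  have hQm := abs_cvM_sub_le hB hη hw hμ hgM hμM
  set s := cvS η w g μ with hs
  set mv := cvM η w g μ with hmv
  have h1 : |g| ≤ |s| + 8 * B ^ 2 * ρ * M := by
    have := abs_sub_abs_le_abs_sub g s
    rw [abs_sub_comm] at hQs
    linarith only [this, hQs]
  have h2 : |μ| ≤ |mv| + B * |g| + 5 * B ^ 2 * ρ * M := by
    have e1 : μ = mv - η * g - (mv - μ - η * g) := by ring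
    have e2 : |η * g| ≤ B * |g| := by
      rw [abs_mul]; exact mul_le_mul_of_nonneg_right hη (abs_nonneg g)
    have e3 := abs_sub (mv - η * g) (mv - μ - η * g)
    have e4 := abs_sub mv (η * g)
    rw [← e1] at e3
    linarith only [e2, e3, e4, hQm]
  have h1B : B * |g| ≤ B * |s| + 8 * B ^ 3 * ρ * M := by
    calc B * |g| ≤ B * (|s| + 8 * B ^ 2 * ρ * M) := mul_le_mul_of_nonneg_left h1 hB0
      _ = B * |s| + 8 * B ^ 3 * ρ * M := by ring
  have hρ' : B ^ 3 * ρ ≤ 1 / 42 := by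
    calc B ^ 3 * ρ ≤ B ^ 3 * (1 / (42 * B ^ 3)) := mul_le_mul_of_nonneg_left hρ (by positivity)
      _ = 1 / 42 := by field_simp
  have hρM : B ^ 3 * ρ * M ≤ M / 42 := by
    calc B ^ 3 * ρ * M ≤ 1 / 42 * M := mul_le_mul_of_nonneg_right hρ' hM0
      _ = M / 42 := by ring
  have hB2 : B ^ 2 * ρ * M ≤ B ^ 3 * ρ * M := by
    have : B ^ 2 ≤ B ^ 3 := pow_le_pow_right₀ hB (by norm_num)
    exact mul_le_mul_of_nonneg_right (mul_le_mul_of_nonneg_right this hρ0) hM0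
  have hBs : 0 ≤ B * |s| := by positivity
  have hBm : 0 ≤ B * |mv| := by positivity
  have hgoal : 2 * (1 + B) * (|s| + |mv|) = 2 * |s| + 2 * |mv| + 2 * (B * |s|) + 2 * (B * |mv|) := by
    ring
  rw [hgoal]
  rcases le_total |g| |μ| with h | h
  · have hMμ : M = |μ| := by rw [hM]; exact max_eq_right h
    linarith only [hMμ, h, h1, h2, h1B, hρM, hB2, hBs, hBm, abs_nonneg s, abs_nonneg mv]
  · have hMg : M = |g| := by rw [hM]; exact max_eq_left h
    linarith only [hMg, h, h1, h2, h1B, hρM, hB2, hBs, hBm, abs_nonneg s, abs_nonneg mv]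

/-- **`T_j` is injective on a `j`-independent ball, quantitatively** (the uniqueness half of
"`T_j⁻¹` exists on `B`"): if `|ĝ|, |μ̂|, |ĝ+p|, |μ̂+q| ≤ ρ ≤ 1/(504B³)` then
`max(|p|,|q|) ≤ 2(1+B)(|T_j(ĝ+p,μ̂+q)_s - T_j(ĝ,μ̂)_s| + |T_j(ĝ+p,μ̂+q)_μ - T_j(ĝ,μ̂)_μ|)`; in
particular `T_j` is injective there and its inverse is `2(1+B)`-Lipschitz (`ℓ^∞`/`ℓ¹` norms).
[cite: Slade2017, Proposition 5.3.1 (existence of `T_j⁻¹` on a `j`-independent ball `B`)] -/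
theorem Slade2017_changeVar_injOn {η w g μ p q B ρ : ℝ} (hB : 1 ≤ B) (hη : |η| ≤ B) (hw : |w| ≤ B)
    (hρ : ρ ≤ 1 / (504 * B ^ 3)) (hg : |g| ≤ ρ) (hμ : |μ| ≤ ρ) (hgp : |g + p| ≤ ρ)
    (hμq : |μ + q| ≤ ρ) :
    max |p| |q| ≤ 2 * (1 + B) * (|cvS η w (g + p) (μ + q) - cvS η w g μ|
      + |cvM η w (g + p) (μ + q) - cvM η w g μ|) := by
  set Δ := max |p| |q| with hΔ
  set m := 2 * ρ with hm
  have hB3 : 1 ≤ B ^ 3 := one_le_pow₀ hB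
  have hρ0 : 0 ≤ ρ := (abs_nonneg g).trans hg
  have hρ1 : ρ ≤ 1 / 2 := hρ.trans (by rw [div_le_div_iff₀ (by positivity) (by norm_num)]; nlinarith)
  have hp : |p| ≤ m := by
    have : |p| = |(g + p) - g| := by ring_nf
    rw [this]; exact (abs_sub _ _).trans (by linarith)
  have hq : |q| ≤ m := by
    have : |q| = |(μ + q) - μ| := by ring_nf
    rw [this]; exact (abs_sub _ _).trans (by linarith)
  have hgm : |g| ≤ m := by linarith
  have hμm : |μ| ≤ m := by linarith
  have hpm := hp
  have hqm := hq
  have hg1 : |g| ≤ 1 := by linarith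
  have hμ1 : |μ| ≤ 1 := by linarith
  have hp1 : |p| ≤ 1 := by linarith
  have hq1 : |q| ≤ 1 := by linarith
  have hpΔ : |p| ≤ Δ := le_max_left _ _
  have hqΔ : |q| ≤ Δ := le_max_right _ _
  have hΔ0 : 0 ≤ Δ := (abs_nonneg p).trans hpΔ
  -- the differences of the quadratic parts
  have hidS : cvS η w (g + p) (μ + q) - cvS η w g μ - p =
      p * ((4 : ℝ) * w * μ + (8 : ℝ) * η * w * g + (4 : ℝ) * w * q + (4 : ℝ) * η * w * p) + q * ((4 : ℝ) * w * g) := by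
    unfold cvS; ring
  have hidM : cvM η w (g + p) (μ + q) - cvM η w g μ - q - η * p =
      p * ((4 : ℝ) * η * w * μ + (4 : ℝ) * η * w * q) + q * ((2 : ℝ) * w * μ + (4 : ℝ) * η * w * g + (1 : ℝ) * w * q) := by
    unfold cvM; ring
  have hSp : |(4 : ℝ) * w * μ + (8 : ℝ) * η * w * g + (4 : ℝ) * w * q + (4 : ℝ) * η * w * p| ≤ (20 : ℝ) * B ^ 2 * m := by
    refine le_of_le_of_eq (abs_add_le_of (abs_add_le_of (abs_add_le_of (abs_coef_mul (abs_top hB (by norm_num) (by norm_num : 1 ≤ 2) (abs_step (abs_base (by norm_num : (0:ℝ) ≤ 4)) hw)) hμm) (abs_coef_mul (abs_top hB (by norm_num) (by norm_num : 2 ≤ 2) (abs_step (abs_step (abs_base (by norm_num : (0:ℝ) ≤ 8)) hη) hw)) hgm)) (abs_coef_mul (abs_top hB (by norm_num) (by norm_num : 1 ≤ 2) (abs_step (abs_base (by norm_num : (0:ℝ) ≤ 4)) hw)) hqm)) (abs_coef_mul (abs_top hB (by norm_num) (by norm_num : 2 ≤ 2) (abs_step (abs_step (abs_base (by norm_num :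 (0:ℝ) ≤ 4)) hη) hw)) hpm)) ?_
    ring
  have hSq : |(4 : ℝ) * w * g| ≤ (4 : ℝ) * B ^ 2 * m := by
    refine le_of_le_of_eq (abs_coef_mul (abs_top hB (by norm_num) (by norm_num : 1 ≤ 2) (abs_step (abs_base (by norm_num : (0:ℝ) ≤ 4)) hw)) hgm) ?_
    ring
  have hMp : |(4 : ℝ) * η * w * μ + (4 : ℝ) * η * w * q| ≤ (8 : ℝ) * B ^ 2 * m := by
    refine le_of_le_of_eq (abs_add_le_of (abs_coef_mul (abs_top hB (by norm_num) (by norm_num : 2 ≤ 2) (abs_step (abs_step (abs_base (by norm_num : (0:ℝ) ≤ 4)) hη) hw)) hμm) (abs_coef_mul (abs_top hB (by norm_num) (by norm_num : 2 ≤ 2) (abs_step (abs_step (abs_base (by norm_num : (0:ℝ) ≤ 4)) hη) hw)) hqm)) ?_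
    ring
  have hMq : |(2 : ℝ) * w * μ + (4 : ℝ) * η * w * g + (1 : ℝ) * w * q| ≤ (7 : ℝ) * B ^ 2 * m := by
    refine le_of_le_of_eq (abs_add_le_of (abs_add_le_of (abs_coef_mul (abs_top hB (by norm_num) (by norm_num : 1 ≤ 2) (abs_step (abs_base (by norm_num : (0:ℝ) ≤ 2)) hw)) hμm) (abs_coef_mul (abs_top hB (by norm_num) (by norm_num : 2 ≤ 2) (abs_step (abs_step (abs_base (by norm_num : (0:ℝ) ≤ 4)) hη) hw)) hgm)) (abs_coef_mul (abs_top hB (by norm_num) (by norm_num : 1 ≤ 2) (abs_step (abs_base (by norm_num : (0:ℝ) ≤ 1)) hw)) hqm)) ?_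
    ring
  have hDS : |cvS η w (g + p) (μ + q) - cvS η w g μ - p| ≤ (20 + 4) * B ^ 2 * m * Δ := by
    rw [hidS]
    have h1 := abs_coef_mul hpΔ hSp
    have h2 := abs_coef_mul hqΔ hSq
    calc _ ≤ Δ * (20 * B ^ 2 * m) + Δ * (4 * B ^ 2 * m) := (abs_add_le _ _).trans (add_le_add h1 h2)
      _ = _ := by ring
  have hDM : |cvM η w (g + p) (μ + q) - cvM η w g μ - q - η * p| ≤ (8 + 7) * B ^ 2 * m * Δ := by
    rw [hidM]
    have h1 := abs_coef_mul hpΔ hMp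
    have h2 := abs_coef_mul hqΔ hMq
    calc _ ≤ Δ * (8 * B ^ 2 * m) + Δ * (7 * B ^ 2 * m) := (abs_add_le _ _).trans (add_le_add h1 h2)
      _ = _ := by ring
  clear hidS hidM hSp hSq hMp hMq
  set dS := cvS η w (g + p) (μ + q) - cvS η w g μ with hdS
  set dMu := cvM η w (g + p) (μ + q) - cvM η w g μ with hdMu
  have hB0 : 0 ≤ B := zero_le_one.trans hB
  have hm0 : 0 ≤ m := by rw [hm]; positivity
  have h1 : |p| ≤ |dS| + (20 + 4) * B ^ 2 * m * Δ := by
    have := abs_sub_abs_le_abs_sub p dS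
    rw [abs_sub_comm] at hDS
    linarith only [this, hDS]
  have h2 : |q| ≤ |dMu| + B * |p| + (8 + 7) * B ^ 2 * m * Δ := by
    have e1 : q = dMu - η * p - (dMu - q - η * p) := by ring
    have e2 : |η * p| ≤ B * |p| := by
      rw [abs_mul]; exact mul_le_mul_of_nonneg_right hη (abs_nonneg p)
    have e3 := abs_sub (dMu - η * p) (dMu - q - η * p)
    have e4 := abs_sub dMu (η * p)
    rw [← e1] at e3
    linarith only [e2, e3, e4, hDM]
  clear hDS hDM
  have h1B : B * |p| ≤ B * |dS| + (20 + 4) * B ^ 3 * m * Δ := by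
    calc B * |p| ≤ B * (|dS| + (20 + 4) * B ^ 2 * m * Δ) :=
          mul_le_mul_of_nonneg_left h1 hB0
      _ = _ := by ring
  have hB2 : B ^ 2 * m * Δ ≤ B ^ 3 * m * Δ := by
    have : B ^ 2 ≤ B ^ 3 := pow_le_pow_right₀ hB (by norm_num)
    exact mul_le_mul_of_nonneg_right (mul_le_mul_of_nonneg_right this hm0) hΔ0
  have hρ' : B ^ 3 * ρ ≤ 1 / 504 := by
    calc B ^ 3 * ρ ≤ B ^ 3 * (1 / (504 * B ^ 3)) := mul_le_mul_of_nonneg_left hρ (by positivity)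
      _ = 1 / 504 := by field_simp
  have hρΔ : B ^ 3 * m * Δ ≤ Δ / 252 := by
    calc B ^ 3 * m * Δ = B ^ 3 * ρ * 2 * Δ := by rw [hm]; ring
      _ ≤ 1 / 504 * 2 * Δ := by gcongr
      _ = Δ / 252 := by ring
  have hBs : 0 ≤ B * |dS| := by positivity
  have hBm : 0 ≤ B * |dMu| := by positivity
  have hgoal : 2 * (1 + B) * (|dS| + |dMu|) =
      2 * |dS| + 2 * |dMu| + 2 * (B * |dS|) + 2 * (B * |dMu|) := by ring
  rw [hgoal]
  rcases le_total |p| |q| with h | h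
  · have hΔq : Δ = |q| := by rw [hΔ]; exact max_eq_right h
    linarith only [hΔq, h, h1, h2, h1B, hB2, hρΔ, hBs, hBm, abs_nonneg dS, abs_nonneg dMu]
  · have hΔp : Δ = |p| := by rw [hΔ]; exact max_eq_left h
    linarith only [hΔp, h, h1, h2, h1B, hB2, hρΔ, hBs, hBm, abs_nonneg dS, abs_nonneg dMu]

/-- **Lemma 7.1.1 (Slade), the `y`-equation — identification and bound of `r_{y,j}`.** Let the
rescaled couplings advance by the renormalisation-group map as
`(ĝ_{j+1}, μ̂_{j+1}) = Φ^{(0)}_{pt,j}(ĝ_j, μ̂_j) + (ρ_g, ρ_μ)` (`ρ_g = L^{ε(j+1)}r_{g,j}`,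
`ρ_μ = L^{α(j+1)}r_{ν,j}`, the rescaled remainders of (7.1 first display)), put
`(s_j, μ_j) = T_j(ĝ_j, μ̂_j)`, `(s_{j+1}, μ_{j+1}) = T_{j+1}(ĝ_{j+1}, μ̂_{j+1})`, `y_j = s̄ - s_j`, and let
`L^ε a s̄ = L^ε - 1` (§5.4). Then
`y_{j+1} = c_ε y_j + aL^ε y_j² + (β^:_j - a)L^ε(s̄ - y_j)² + r_{y,j}` (display (7.1.1), second
line) with
`|r_{y,j}| ≤ 4B³(L^ε - 1)s_j² + 1968B^{10}(|ĝ_j|³ + |μ̂_j|³) + 21B²(|ρ_g| + |ρ_μ|)`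
(for `|ĝ_j|, |μ̂_j|, |Φ^{(0)}(ĝ_j,μ̂_j)_{1,2}|, |ρ_g|, |ρ_μ| ≤ 1`, coefficients bounded by `B`, `L^ε ≥ 1`).
In the flow of §7.2 (`|ĝ_j|, |μ̂_j| = O(s̄)` by `Slade2017_changeVar_apriori`, `ρ = O(s̄³)` by the
bounds on `R_+` of Theorem 6.3.1, `L^ε - 1 = O(ε)` by `rpow_sub_one_le` and `s̄ ≍ ε` by §5.4) this
is the printed `|r_{y,j}| ≤ O(s̄³)` with `L`-dependent constant; the `K`-dependence and the
derivative bounds of Lemma 7.1.1 are not treated here.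
[cite: Slade2017, Lemma 7.1.1 (display (7.1.1) and its proof: "Proposition 5.3.1, (5.4.0), and the bounds on `R_+`")] -/
theorem Slade2017_lem711_y {Lε Lα r β γh ξ w₀ w₁ η η₀ η₁ B a sb ρg ρμ g μ : ℝ}
    (hr : Lε = r * Lα) (hη : η = η₀ - r * η₁) (hB : 1 ≤ B) (hLα : |Lα| ≤ B) (hr1 : |r| ≤ 1)
    (hβ : |β| ≤ B) (hγ : |γh| ≤ B) (hξ : |ξ| ≤ B) (hw₀ : |w₀| ≤ B) (hw₁ : |w₁| ≤ B)
    (hη₀ : |η₀| ≤ B) (hη₁ : |η₁| ≤ B) (hg : |g| ≤ 1) (hμ : |μ| ≤ 1) (hLε : 1 ≤ Lε)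
    (hG : |ptFlowG Lε Lα β η w₀ w₁ g μ| ≤ 1) (hM : |ptFlowM Lα β γh ξ η w₀ w₁ g μ| ≤ 1)
    (hρg : |ρg| ≤ 1) (hρμ : |ρμ| ≤ 1) (hfix : Lε * a * sb = Lε - 1) :
    |(sb - cvS η₁ w₁ (ptFlowG Lε Lα β η w₀ w₁ g μ + ρg) (ptFlowM Lα β γh ξ η w₀ w₁ g μ + ρμ))
        - ((2 - Lε) * (sb - cvS η₀ w₀ g μ)
          + Lε * (a * (sb - cvS η₀ w₀ g μ) ^ 2
            + (betaW β η₀ w₀ η₁ w₁ - a) * cvS η₀ w₀ g μ ^ 2))|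
      ≤ 4 * B ^ 3 * (Lε - 1) * cvS η₀ w₀ g μ ^ 2 + 1968 * B ^ 10 * (|g| ^ 3 + |μ| ^ 3)
        + 21 * B ^ 2 * (|ρg| + |ρμ|) := by
  set G' := ptFlowG Lε Lα β η w₀ w₁ g μ with hG'
  set M' := ptFlowM Lα β γh ξ η w₀ w₁ g μ with hM'
  set s := cvS η₀ w₀ g μ with hs
  set βW := betaW β η₀ w₀ η₁ w₁ with hβW
  have hy := Slade2017_ybar_recursion hfix βW (sb - s)
  have hss : sb - (sb - s) = s := by ring
  rw [hss] at hy
  -- decomposition of r_y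
  have hdec : (sb - cvS η₁ w₁ (G' + ρg) (M' + ρμ))
        - ((2 - Lε) * (sb - s) + Lε * (a * (sb - s) ^ 2 + (βW - a) * s ^ 2))
      = -((cvS η₁ w₁ (G' + ρg) (M' + ρμ) - cvS η₁ w₁ G' M')
          + (cvS η₁ w₁ G' M' - barFlowS Lε βW s - 4 * Lε * (Lε - 1) * η₁ * w₁ * s ^ 2)
          + 4 * Lε * (Lε - 1) * η₁ * w₁ * s ^ 2) := by
    rw [← hy]; ring
  rw [hdec, abs_neg]
  have h1 : |cvS η₁ w₁ (G' + ρg) (M' + ρμ) - cvS η₁ w₁ G' M'| ≤ 21 * B ^ 2 * (|ρg| + |ρμ|) :=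
    cvS_add_sub_cvS_le hB hη₁ hw₁ hG hM hρg hρμ
  have h2 : |cvS η₁ w₁ G' M' - barFlowS Lε βW s - 4 * Lε * (Lε - 1) * η₁ * w₁ * s ^ 2|
      ≤ 1968 * B ^ 10 * (|g| ^ 3 + |μ| ^ 3) :=
    Slade2017_prop531_fst hr hη hB hLα hr1 hβ hγ hξ hw₀ hw₁ hη₀ hη₁ hg hμ
  have hLεB : |Lε| ≤ B := by
    rw [hr, abs_mul]
    calc |r| * |Lα| ≤ 1 * B := mul_le_mul hr1 hLα (abs_nonneg _) zero_le_one
      _ = B := one_mul B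
  have h3 : |4 * Lε * (Lε - 1) * η₁ * w₁ * s ^ 2| ≤ 4 * B ^ 3 * (Lε - 1) * s ^ 2 := by
    rw [abs_mul, abs_mul, abs_mul, abs_mul, abs_mul, abs_of_nonneg (sub_nonneg.2 hLε),
      abs_of_pos (by norm_num : (0:ℝ) < 4), abs_pow, sq_abs]
    have h0 : 0 ≤ Lε - 1 := sub_nonneg.2 hLε
    have := mul_le_mul (mul_le_mul hLεB hη₁ (abs_nonneg _) ((abs_nonneg _).trans hLεB)) hw₁
      (abs_nonneg _) (by positivity)
    calc 4 * |Lε| * (Lε - 1) * |η₁| * |w₁| * s ^ 2 = 4 * (Lε - 1) * s ^ 2 * (|Lε| * |η₁| * |w₁|) := by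
          ring
      _ ≤ 4 * (Lε - 1) * s ^ 2 * (B * B * B) :=
          mul_le_mul_of_nonneg_left this (by positivity)
      _ = 4 * B ^ 3 * (Lε - 1) * s ^ 2 := by ring
  have hXY := abs_add_le (cvS η₁ w₁ (G' + ρg) (M' + ρμ) - cvS η₁ w₁ G' M')
    (cvS η₁ w₁ G' M' - barFlowS Lε βW s - 4 * Lε * (Lε - 1) * η₁ * w₁ * s ^ 2)
  have hXYZ := abs_add_le
    (cvS η₁ w₁ (G' + ρg) (M' + ρμ) - cvS η₁ w₁ G' M'
      + (cvS η₁ w₁ G' M' - barFlowS Lε βW s - 4 * Lε * (Lε - 1) * η₁ * w₁ * s ^ 2))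
    (4 * Lε * (Lε - 1) * η₁ * w₁ * s ^ 2)
  linarith

/-- **Lemma 7.1.1 (Slade), the `μ`-equation — identification and bound of `r_{μ,j}`.** In the
setting of `Slade2017_lem711_y`,
`μ_{j+1} = L^α μ_j + ρ_{μ,j} + r_{μ,j}`, `ρ_{μ,j} = -L^α(γ̂β_jμ_js_j + ξ^W_j s_j²)` (`s_j = s̄ - y_j`;
display (7.1.1), first line, and the display defining `ρ_{μ,j}`), with
`|r_{μ,j}| ≤ 1667B^{11}(|ĝ_j|³ + |μ̂_j|³) + 9B²(|ρ_g| + |ρ_μ|)` (here only `|ρ_μ| ≤ 1` is needed) — the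
printed `|r_{μ,j}| ≤ O(s̄³)` under the same provisos as for `r_{y,j}`.
[cite: Slade2017, Lemma 7.1.1 (display (7.1.1), first line) and §7.1 (display defining `ρ_{μ,j}`)] -/
theorem Slade2017_lem711_mu {Lε Lα r β γh ξ w₀ w₁ η η₀ η₁ B ρg ρμ g μ : ℝ}
    (hr : Lε = r * Lα) (hη : η = η₀ - r * η₁) (hB : 1 ≤ B) (hLα : |Lα| ≤ B) (hr1 : |r| ≤ 1)
    (hβ : |β| ≤ B) (hγ : |γh| ≤ B) (hξ : |ξ| ≤ B) (hw₀ : |w₀| ≤ B) (hw₁ : |w₁| ≤ B)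
    (hη₀ : |η₀| ≤ B) (hη₁ : |η₁| ≤ B) (hg : |g| ≤ 1) (hμ : |μ| ≤ 1)
    (hG : |ptFlowG Lε Lα β η w₀ w₁ g μ| ≤ 1) (hM : |ptFlowM Lα β γh ξ η w₀ w₁ g μ| ≤ 1)
    (hρμ : |ρμ| ≤ 1) :
    |cvM η₁ w₁ (ptFlowG Lε Lα β η w₀ w₁ g μ + ρg) (ptFlowM Lα β γh ξ η w₀ w₁ g μ + ρμ)
        - (Lα * cvM η₀ w₀ g μ
          + -(Lα * (γh * β * cvM η₀ w₀ g μ * cvS η₀ w₀ g μ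
            + xiW r β γh ξ η₀ η₁ * cvS η₀ w₀ g μ ^ 2)))|
      ≤ 1667 * B ^ 11 * (|g| ^ 3 + |μ| ^ 3) + 9 * B ^ 2 * (|ρg| + |ρμ|) := by
  set G' := ptFlowG Lε Lα β η w₀ w₁ g μ with hG'
  set M' := ptFlowM Lα β γh ξ η w₀ w₁ g μ with hM'
  set s := cvS η₀ w₀ g μ with hs
  set mv := cvM η₀ w₀ g μ with hmv
  set ξW := xiW r β γh ξ η₀ η₁ with hξW
  have hbar : Lα * mv + -(Lα * (γh * β * mv * s + ξW * s ^ 2)) = barFlowM Lα γh β ξW s mv := by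
    unfold barFlowM; ring
  have hdec : cvM η₁ w₁ (G' + ρg) (M' + ρμ) - (Lα * mv + -(Lα * (γh * β * mv * s + ξW * s ^ 2)))
      = (cvM η₁ w₁ (G' + ρg) (M' + ρμ) - cvM η₁ w₁ G' M')
        + (cvM η₁ w₁ G' M' - barFlowM Lα γh β ξW s mv) := by
    rw [hbar]; ring
  rw [hdec]
  have h1 : |cvM η₁ w₁ (G' + ρg) (M' + ρμ) - cvM η₁ w₁ G' M'| ≤ 9 * B ^ 2 * (|ρg| + |ρμ|) :=
    cvM_add_sub_cvM_le hB hη₁ hw₁ hG hM hρμ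
  have h2 : |cvM η₁ w₁ G' M' - barFlowM Lα γh β ξW s mv| ≤ 1667 * B ^ 11 * (|g| ^ 3 + |μ| ^ 3) :=
    Slade2017_prop531_snd hr hη hB hLα hr1 hβ hγ hξ hw₀ hw₁ hη₀ hη₁ hg hμ
  calc _ ≤ |cvM η₁ w₁ (G' + ρg) (M' + ρμ) - cvM η₁ w₁ G' M'|
        + |cvM η₁ w₁ G' M' - barFlowM Lα γh β ξW s mv| := abs_add_le _ _
    _ ≤ _ := by linarith

end LongRangePhi4

end Literature.Barriers.CriticalPhenomena

end
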